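import Mathlib
import Literature.NumberTheory.LFunctions.Zhang2022.Section8DiscreteMeanSquare
import Literature.NumberTheory.LFunctions.Zhang2022.Section12E2ShiftMeanSquare
import Literature.NumberTheory.LFunctions.Zhang2022.Section12Ded1217Sizes
import Literature.NumberTheory.LFunctions.Zhang2022.Section5Lemma51
import HarnessLib

/-!
# Zhang (2022) §12 (12.8): the deduction `Z22:(12.8)` reduced to ONE unprinted window
# `S_j`-estimate (the cell's `Ded128R`, proved)

Topic `Literature/NumberTheory/LFunctions/Zhang2022` (Landau–Siegel audit tree; verdict-neutral).
Y. Zhang, *Discrete mean estimates and the Landau–Siegel zero*, arXiv:2211.02515v1 (2022)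
[Zhang2022LandauSiegel], §12 p. 67, tex L3424–L3447 — **an unrefereed manuscript under
adjudication; nothing here asserts or denies its Theorems 1–2.** THEOREMS ONLY; 0 new definitions,
0 new facts (ZHANG-L lane, LIB-B floater under leaf hXi `Typed.Sec12A.Xi15Hbar16`; GAP row G-d42-3).

The manuscript deduces (12.8) `ΣΣ𝔠*(ρ,ψ)|Z(ρ,ψχ)⁻¹H̃₁₅(ρ,ψ) − H̄₁₆(1−ρ,ψ̄)|²ω(ρ) = o(𝔞𝔓)` by the
sentence "Thus, in a way similar to the proof of Proposition 2.6, by the above discussion we deduce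
(12.8)" (tex L3440); the typed node `Typed.Sec12A.Ded128 c′` lists as antecedents the three items of
"the above discussion" (the `H̃₁₅` approximate functional equation `Htilde15ApproxFE`, the tails
`DualTailsSmall`, the integral `IntGDual`) and, by analogy with §11, `E2ShiftMeanSq`, Lemma 8.1,
Prop. 7.1, Prop. 2.2 (i), "`ψχ` primitive". The cell's row G-d42-3 records that two inputs are
missing from both the print and the typing: (i) Lemma 5.1 (5.4) at modulus `DPt₀`, which turns
`Z(ρ,ψχ)⁻¹Z(ρ+β₆,ψχ)P₁^{β₆}n^{β₆}` into `(n/P″₁)^{β₆}` (`P₁P″₁ = DPt₀` exactly) up to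
`O(α𝓛⁻⁶⁸)`; (ii) an `S_j`-smallness `hS′` for the DUAL-SIDE COEFFICIENT DIFFERENCE
`c(n) = χ(n)(n/P″₁)^{β₆}[I_D(n)/0.504·1_{P″₁η₋<n<P″₂η₊} − log(n/P″₁)/log P₁·1_{P″₁<n<P″₂}]`,
`I_D(n) = ∫_{0.496}^{0.5}{g(P^{0.5}Dt₀/n) − g(P^zDt₀/n)}dz`, which `IntGDual` makes `O(e^{−c𝓛¹⁰})` in
the bulk but which is `O(10⁻²)` on the two edge windows at `P″₁`, `P″₂` (the window structure of
(12.6) and of §11's `Step11u019`). THIS FILE PROVES the repaired deduction `Ded128R`: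

* `dualTerm_tsum_split` — the dual series splits as (tail series of `DualTailsSmall`) + (finite main
  sum over `P″₁η₋ < n < P″₂η₊`), with the summability bookkeeping;
* `pointwise_decomp` — at `s` on the critical line, the exact identity
  `Z⁻¹H̃₁₅ − H̄₁₆(1−s) = Z⁻¹(H̃₁₅ − pref·Σ'dualTerm) + Z⁻¹pref·(tail) + (u−1)·A(𝐜₀;1−s,ψ̄) + A(𝐜;1−s,ψ̄)`
  with `u = Z(s,ψχ)⁻¹Z(s+β₆,ψχ)(DPt₀)^{β₆}`, `c₀(n) = χ(n)(n/P″₁)^{β₆}I_D(n)/0.504·1_{main}`;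
* `norm_u_sub_one_le` — `|u − 1| ≤ C₅₁·(3α/2)·𝓛⁻⁶⁸` from Lemma 5.1 (5.4) (`Skeleton.lemma51_holds`)
  and `|Z(ρ,ψχ)| = 1` (Prop. 2.2 (i), `ψχ` primitive);
* `eq128_of_sj_small` — **(12.8) from Lemma 8.1, Prop. 7.1, the `H̃₁₅` approximate functional
  equation (repaired with the `e^{−c𝓛¹⁰}` of Lemma 6.1, as Lemma 11.2 → `Step11u024e` of record;
  the printed form implies it) and the ONE estimate `hS′`: `S_j(𝐜̄,𝐜) = o(α𝔞)`** — the four mean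
  squares being `E2ShiftMeanSq` (tree, `Section12E2ShiftMeanSquare`), the total mass
  `ΣΣ𝔠*ω ≪ 𝓛⁹𝔓` (`Section11Deductions.totalMass_le`) against `e^{−2c𝓛¹⁰}`, the crude
  `ΣΣ𝔠*|A(𝐜̄₀)|²ω ≪ 𝓛⁸¹𝔓` (`DiscreteMeanSquare.meanSq_le_polylog`) against `(α𝓛⁻⁶⁸)²`, and
  `DiscreteMeanSquare.meanSq_le_of_sj_small` for `𝐜̄`;
* `eq128_of_sj_small_eventually` — closed form for every sufficiently large `c′` (only the AFE and
  `hS′` remain as hypotheses).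

## References

* Y. Zhang, arXiv:2211.02515v1 (2022), §12 p. 67 (tex L3424–L3447), §11 pp. 64–66, §5 Lemma 5.1
  (5.4), §7 Prop. 7.1, §8 Lemma 8.1. [cite: Zhang2022LandauSiegel, §12 (12.8) p.67]
-/

noncomputable section

open Complex Real ComplexConjugate

namespace Literature.NumberTheory.LFunctions.Zhang2022.Typed.Sec12A

open Skeleton Section11E2MeanSquare DiscreteMeanSquare
open Section11Deductions (mem_idx totalMass_le)

/-! ## §1. Elementary helpers -/

/-- For `D ≥ ⌈e^M⌉`, `𝓛 = log D ≥ M`. [cite: Zhang2022LandauSiegel, §2 p.4] -/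
private theorem le_ell_of_ceil_exp_le {M : ℝ} {D : ℕ} (hD : ⌈Real.exp M⌉₊ ≤ D) : M ≤ ell D := by
  have h : Real.exp M ≤ D := le_trans (Nat.le_ceil _) (by exact_mod_cast hD)
  exact (Real.le_log_iff_exp_le (lt_of_lt_of_le (Real.exp_pos _) h)).mpr h

/-- `β₆ = (3α/2)·i` as a real multiple of `i`. [cite: Zhang2022LandauSiegel, §2 (2.22)] -/
theorem beta6_eq_mul_I (D : ℕ) : beta6 D = ((3 * alpha D / 2 : ℝ) : ℂ) * I := by
  simp only [beta6]; push_cast; ring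

/-- `(a/b)^w · b^w = a^w` for positive reals `a, b` (complex power of positive reals).
[folklore] -/
private theorem div_cpow_mul_cpow {a b : ℝ} (ha : 0 ≤ a) (hb : 0 < b) (w : ℂ) :
    ((a / b : ℝ) : ℂ) ^ w * ((b : ℝ) : ℂ) ^ w = ((a : ℝ) : ℂ) ^ w := by
  rw [← Complex.mul_cpow_ofReal_nonneg (div_nonneg ha hb.le) hb.le]
  congr 1
  have hb' : (b : ℂ) ≠ 0 := by exact_mod_cast hb.ne'
  push_cast
  field_simp

/-- `(a·b)^w = a^w · b^w` for non-negative reals, cast form. [folklore] -/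
private theorem mul_cpow_real {a b : ℝ} (ha : 0 ≤ a) (hb : 0 ≤ b) (w : ℂ) :
    ((a * b : ℝ) : ℂ) ^ w = ((a : ℝ) : ℂ) ^ w * ((b : ℝ) : ℂ) ^ w := by
  rw [← Complex.mul_cpow_ofReal_nonneg ha hb]; push_cast; rfl

/-- `P₁·P″₁ = D·P·t₀` (`P^{0.504}·P^{0.496} = P`). [cite: Zhang2022LandauSiegel, §12 p.67; §2 (2.21)] -/
theorem P1_mul_P1pp (D : ℕ) : Skeleton.P1 D * P1pp D = (D : ℝ) * bigP D * t0 D := by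
  have hP : 0 < bigP D := bigP_pos D
  have h1 : bigP D ^ (0.504 : ℝ) * bigP D ^ (0.496 : ℝ) = bigP D := by
    rw [← Real.rpow_add hP]; norm_num
  rw [Skeleton.P1, P1pp, show bigP D ^ (0.504 : ℝ) * (bigP D ^ (0.496 : ℝ) * D * t0 D) =
    (bigP D ^ (0.504 : ℝ) * bigP D ^ (0.496 : ℝ)) * D * t0 D by ring, h1]
  ring

/-- `ψ̄(n) = ψ⁻¹(n)` for the coefficient character. [folklore] -/
private theorem conj_psi_eq_inv {D : ℕ} (x : Chr D) (n : ℕ) :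
    conj (x.ψ (n : ZMod x.p)) = x.ψ⁻¹ (n : ZMod x.p) := by
  rw [← MulChar.star_apply']; rfl

/-- **`P″₂η₊ ≤ PT⁻²`** for `𝓛 ≥ 3`: the support of the dual main sum lies below the truncation of
(7.2). [cite: Zhang2022LandauSiegel, §12 p.67, §7 (7.2)] -/
theorem P2pp_eta_le_P_div_T_sq {D : ℕ} (hD : 3 ≤ Real.log D) :
    P2pp D * etaPM D 1 ≤ bigP D / bigT D ^ 2 := by
  have hD1 : 1 ≤ Real.log D := by linarith
  have hℓ : 3 ≤ ell D := by rw [ell]; exact hD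
  have h1 : (1 : ℝ) ≤ ell D := by linarith
  have h0 : (0 : ℝ) ≤ ell D := by linarith
  have hη : etaPM D 1 ≤ Real.exp 1 := by
    rw [etaPM, one_mul]
    exact Real.exp_le_exp.mpr (inv_le_one_of_one_le₀ (one_le_pow₀ h1))
  have hbound : P2pp D ≤ Real.exp (0.5 * ell D ^ 9 + 520 * ell D) := by
    rw [P2pp, Sec12D.natCast_eq_exp_ell hD1, bigP, ← Real.exp_mul,
      show 0.5 * ell D ^ 9 + 520 * ell D = (ell D ^ 9 * 0.5 + ell D) + 519 * ell D by ring,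
      Real.exp_add, Real.exp_add]
    exact mul_le_mul_of_nonneg_left (Sec12D.t0_le_exp hD1) (by positivity)
  have h2 : P2pp D * etaPM D 1 ≤ Real.exp (0.5 * ell D ^ 9 + 520 * ell D + 1) := by
    rw [Real.exp_add]
    exact mul_le_mul hbound hη (by rw [etaPM]; positivity) (by positivity)
  refine h2.trans ?_
  rw [bigP, bigT, ← Real.exp_nat_mul, ← Real.exp_sub, Real.exp_le_exp]
  have h11 : ell D ^ (1.1 : ℝ) ≤ ell D ^ (2 : ℝ) :=
    Real.rpow_le_rpow_of_exponent_le h1 (by norm_num)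
  rw [Real.rpow_two] at h11
  have h7 : (3 : ℝ) ^ 7 ≤ ell D ^ 7 := pow_le_pow_left₀ (by norm_num) hℓ 7
  push_cast
  nlinarith [pow_nonneg h0 2, show ell D ^ 9 = ell D ^ 2 * ell D ^ 7 by ring,
    mul_le_mul_of_nonneg_left h7 (pow_nonneg h0 2)]

/-! ## §2. The main range, the coefficient sequences, and the split of the dual series -/

section Objects

variable {D : ℕ} (χ : DirichletCharacter ℂ D) (x : Chr D)

/-- `dualTerm(s,n)` restricted to the main range `P″₁η₋ < n < P″₂η₊` is finitely supported, the
rest being the tail of `DualTailsSmall`; for `n ≥ 1` exactly one alternative holds, and `n = 0`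
contributes nothing (`dualTerm(s,0) = 0`). [cite: Zhang2022LandauSiegel, §12 p.67] -/
theorem dualTerm_eq_tail_add_main {s : ℂ} (hs : s.re = 1 / 2) (n : ℕ) :
    dualTerm χ x s n =
      (if (n : ℝ) ≤ P1pp D * etaPM D (-1) ∨ P2pp D * etaPM D 1 ≤ n then dualTerm χ x s n else 0) +
      (if n ∈ (Finset.Ico 1 ⌈P2pp D * etaPM D 1⌉₊).filter
          (fun n : ℕ => P1pp D * etaPM D (-1) < n ∧ (n : ℝ) < P2pp D * etaPM D 1)
        then dualTerm χ x s n else 0) := by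
  by_cases ht : (n : ℝ) ≤ P1pp D * etaPM D (-1) ∨ P2pp D * etaPM D 1 ≤ n
  · rw [if_pos ht, if_neg, add_zero]
    intro hm
    rw [Finset.mem_filter] at hm
    rcases ht with h | h
    · linarith [hm.2.1]
    · linarith [hm.2.2]
  · rw [if_neg ht, zero_add]
    push Not at ht
    rcases Nat.eq_zero_or_pos n with rfl | hn
    · rw [dualTerm_zero χ x hs]; split_ifs <;> rfl
    · rw [if_pos]
      refine Finset.mem_filter.mpr ⟨Finset.mem_Ico.mpr ⟨hn, Nat.lt_ceil.mpr ht.2⟩, ht.1, ht.2⟩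

/-- The tail series of `DualTailsSmall` is absolutely summable (dominated by `K·n⁻²`,
`norm_dualTerm_tail_le`), for `𝓛 > 0`, `𝓛²⁰ ≥ 2`, `σ = ½`. [cite: Zhang2022LandauSiegel, §12 p.67] -/
theorem summable_dualTail (hℓ : 0 < ell D) (hκ : 2 ≤ ell D ^ 20) (hD0 : 0 < (D : ℝ)) {s : ℂ}
    (hs : s.re = 1 / 2) :
    Summable fun n : ℕ =>
      (if (n : ℝ) ≤ P1pp D * etaPM D (-1) ∨ P2pp D * etaPM D 1 ≤ n then dualTerm χ x s n else 0) := by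
  set K : ℝ := 0.004 * Real.exp (2 * (ell D ^ 10)⁻¹ - ell D ^ 10) * P2pp D ^ 2 with hK
  have hle : ∀ n : ℕ, ‖(if (n : ℝ) ≤ P1pp D * etaPM D (-1) ∨ P2pp D * etaPM D 1 ≤ n then
      dualTerm χ x s n else 0)‖ ≤ K * (1 / (n : ℝ) ^ 2) := by
    intro n
    rcases Nat.eq_zero_or_pos n with rfl | hn
    · have h0 : (if ((0 : ℕ) : ℝ) ≤ P1pp D * etaPM D (-1) ∨ P2pp D * etaPM D 1 ≤ ((0 : ℕ) : ℝ) then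
          dualTerm χ x s 0 else 0) = 0 := by
        split_ifs
        · exact dualTerm_zero χ x hs
        · rfl
      rw [h0, norm_zero, Nat.cast_zero]
      simp
    · split_ifs with htail
      · exact norm_dualTerm_tail_le χ x hℓ hκ hD0 hs hn htail
      · rw [norm_zero]; positivity
  exact Summable.of_norm_bounded (hasSum_zeta_two.mul_left K).summable hle

/-- **The split of the dual series**: `Σ'_n dualTerm(s,n) = (tail series) + Σ_{P″₁η₋<n<P″₂η₊} dualTerm(s,n)`.
[cite: Zhang2022LandauSiegel, §12 p.67] -/
theorem dualTerm_tsum_split (hℓ : 0 < ell D) (hκ : 2 ≤ ell D ^ 20) (hD0 : 0 < (D : ℝ)) {s : ℂ}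
    (hs : s.re = 1 / 2) :
    ∑' n : ℕ, dualTerm χ x s n =
      (∑' n : ℕ, (if (n : ℝ) ≤ P1pp D * etaPM D (-1) ∨ P2pp D * etaPM D 1 ≤ n then
        dualTerm χ x s n else 0)) +
      ∑ n ∈ (Finset.Ico 1 ⌈P2pp D * etaPM D 1⌉₊).filter
          (fun n : ℕ => P1pp D * etaPM D (-1) < n ∧ (n : ℝ) < P2pp D * etaPM D 1),
        dualTerm χ x s n := by
  set S := (Finset.Ico 1 ⌈P2pp D * etaPM D 1⌉₊).filter
    (fun n : ℕ => P1pp D * etaPM D (-1) < n ∧ (n : ℝ) < P2pp D * etaPM D 1) with hS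
  have hmainS : Summable (fun n : ℕ => if n ∈ S then dualTerm χ x s n else 0) :=
    summable_of_ne_finset_zero (s := S) (fun n hn => if_neg hn)
  have hmainT : ∑' n : ℕ, (if n ∈ S then dualTerm χ x s n else 0) = ∑ n ∈ S, dualTerm χ x s n := by
    rw [tsum_eq_sum (s := S) (fun n hn => if_neg hn)]
    exact Finset.sum_congr rfl fun n hn => if_pos hn
  have htail := summable_dualTail χ x hℓ hκ hD0 hs
  calc ∑' n : ℕ, dualTerm χ x s n
      = ∑' n : ℕ, ((if (n : ℝ) ≤ P1pp D * etaPM D (-1) ∨ P2pp D * etaPM D 1 ≤ n then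
            dualTerm χ x s n else 0) + (if n ∈ S then dualTerm χ x s n else 0)) :=
        tsum_congr fun n => dualTerm_eq_tail_add_main χ x hs n
    _ = _ := by rw [htail.tsum_add hmainS, hmainT]

end Objects

/-! ## §3. The pointwise identity behind (12.8) -/

section Pointwise

variable {D : ℕ} [NeZero D] (χ : DirichletCharacter ℂ D) (x : Chr D)

omit [NeZero D] in
/-- `dualTerm(s,n) = χ(n)ψ̄(n)·n^{β₆}·n^{−(1−s)}·I_D(n)` for `n ≥ 1` (`n^{−(1−s−β₆)} = n^{β₆}n^{−(1−s)}`).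
[cite: Zhang2022LandauSiegel, §12 p.67] -/
theorem dualTerm_eq {n : ℕ} (hn : 1 ≤ n) (s : ℂ) :
    dualTerm χ x s n = χ (n : ZMod D) * conj (x.ψ (n : ZMod x.p)) *
      ((n : ℂ) ^ beta6 D * (n : ℂ) ^ (-(1 - s))) * ((dualInt D n : ℝ) : ℂ) := by
  have hn0 : (n : ℂ) ≠ 0 := by exact_mod_cast (by omega : n ≠ 0)
  have hrw : dualTerm χ x s n = χ (n : ZMod D) * conj (x.ψ (n : ZMod x.p)) /
      (n : ℂ) ^ (1 - s - beta6 D) * ((dualInt D n : ℝ) : ℂ) := rfl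
  rw [hrw, div_eq_mul_inv, ← Complex.cpow_neg,
    show -(1 - s - beta6 D) = beta6 D + -(1 - s) by ring, Complex.cpow_add _ _ hn0]

/-- Termwise: `Z(s,ψχ)⁻¹·pref(s)·dualTerm(s,n) = u(s)·c₀(n)·ψ̄(n)n^{−(1−s)}` with
`u = Z(s)⁻¹Z(s+β₆)(DPt₀)^{β₆}`, `c₀(n) = χ(n)(n/P″₁)^{β₆}I_D(n)/0.504` (`P₁^{β₆}P″₁^{β₆} = (DPt₀)^{β₆}`,
`(n/P″₁)^{β₆}P″₁^{β₆} = n^{β₆}`), for `n ≥ 1`, `𝓛 ≥ 1`. [cite: Zhang2022LandauSiegel, §12 p.67] -/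
theorem inv_Zpc_mul_pref_mul_dualTerm (hD : 1 ≤ Real.log D) {n : ℕ} (hn : 1 ≤ n) (s : ℂ) :
    (Zpc χ x s)⁻¹ * (dualPrefactor χ x s * dualTerm χ x s n) =
      ((Zpc χ x s)⁻¹ * Zpc χ x (s + beta6 D) * (((D : ℝ) * bigP D * t0 D : ℝ) : ℂ) ^ beta6 D) *
        ((χ (n : ZMod D) * (((n : ℝ) / P1pp D : ℝ) : ℂ) ^ beta6 D *
          ((dualInt D n / 0.504 : ℝ) : ℂ)) * x.ψ⁻¹ (n : ZMod x.p) * (n : ℂ) ^ (-(1 - s))) := by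
  have hP1pp : 0 < P1pp D := Sec12D.P1pp_pos hD
  have hP1 : 0 < Skeleton.P1 D := Real.rpow_pos_of_pos (bigP_pos D) _
  have hR : (((D : ℝ) * bigP D * t0 D : ℝ) : ℂ) ^ beta6 D =
      ((Skeleton.P1 D : ℝ) : ℂ) ^ beta6 D * ((P1pp D : ℝ) : ℂ) ^ beta6 D := by
    rw [← P1_mul_P1pp, mul_cpow_real hP1.le hP1pp.le]
  have hW : (((n : ℝ) / P1pp D : ℝ) : ℂ) ^ beta6 D * ((P1pp D : ℝ) : ℂ) ^ beta6 D =
      (n : ℂ) ^ beta6 D := by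
    rw [div_cpow_mul_cpow (Nat.cast_nonneg n) hP1pp, Complex.ofReal_natCast]
  have hI : ((dualInt D n / 0.504 : ℝ) : ℂ) = ((dualInt D n : ℝ) : ℂ) / ((0.504 : ℝ) : ℂ) :=
    Complex.ofReal_div _ _
  rw [dualTerm_eq χ x hn, conj_psi_eq_inv, dualPrefactor, hR, hI, ← hW]
  ring

omit [NeZero D] in
/-- The conjugate-side Dirichlet polynomial of a sequence supported on a finset `S ⊆ [0, PT⁻²)`:
`A(𝐚;w,ψ̄) = Σ_{n∈S} a(n)ψ̄(n)n^{−w}` when `a = 1_S·f`. [cite: Zhang2022LandauSiegel, §7 p.13] -/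
theorem ApolyBar_ite (S : Finset ℕ) (hS : S ⊆ Finset.range (Nsupp D)) (f : ℕ → ℂ) (w : ℂ) :
    ApolyBar x (fun n => if n ∈ S then f n else 0) w =
      ∑ n ∈ S, f n * x.ψ⁻¹ (n : ZMod x.p) * (n : ℂ) ^ (-w) := by
  rw [ApolyBar, Lemma81.dirPoly_def]
  have e : ∀ n ∈ Finset.range (Nsupp D),
      (if n ∈ S then f n else 0) * x.ψ⁻¹ n * (n : ℂ) ^ (-w) =
        (if n ∈ S then f n * x.ψ⁻¹ (n : ZMod x.p) * (n : ℂ) ^ (-w) else 0) := by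
    intro n _
    split_ifs <;> simp
  rw [Finset.sum_congr rfl e, Finset.sum_ite_mem, Finset.inter_eq_right.mpr hS]

omit [NeZero D] in
/-- The conjugate-side Dirichlet polynomial is additive in the coefficient sequence (difference).
[cite: Zhang2022LandauSiegel, §7 p.13] -/
theorem ApolyBar_sub (a b : ℕ → ℂ) (w : ℂ) :
    ApolyBar x (fun n => a n - b n) w = ApolyBar x a w - ApolyBar x b w := by
  rw [ApolyBar, ApolyBar, ApolyBar, Lemma81.dirPoly_def, Lemma81.dirPoly_def, Lemma81.dirPoly_def,
    ← Finset.sum_sub_distrib]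
  exact Finset.sum_congr rfl fun n _ => by ring

omit [NeZero D] in
/-- **`H̄₁₆(1−s,ψ̄) = A(𝐜₁;1−s,ψ̄)`** with `c₁(n) = χ(n)(n/P″₁)^{β₆}log(n/P″₁)/log P₁·1_{P″₁<n<P″₂}`
(`𝓛 ≥ 3`, so that `⌈P″₂⌉ ≤ ⌈PT⁻²⌉`). [cite: Zhang2022LandauSiegel, §12 p.67 (the «where» display)] -/
theorem Hbar16_eq_ApolyBar (hD : 3 ≤ Real.log D) (w : ℂ) :
    Hbar16 χ x w = ApolyBar x (fun n : ℕ => (if n ∈ ((Finset.Ico 1 ⌈P2pp D⌉₊).filter (fun n : ℕ => P1pp D < n ∧ (n : ℝ) < P2pp D)) then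
          χ (n : ZMod D) * (((n : ℝ) / P1pp D : ℝ) : ℂ) ^ beta6 D *
            ((Real.log ((n : ℝ) / P1pp D) / Real.log (Skeleton.P1 D) : ℝ) : ℂ)
        else 0)) w := by
  have hsub : ((Finset.Ico 1 ⌈P2pp D⌉₊).filter (fun n : ℕ => P1pp D < n ∧ (n : ℝ) < P2pp D)) ⊆
      Finset.range (Nsupp D) := by
    intro n hn
    rw [Finset.mem_filter, Finset.mem_Ico] at hn
    exact Finset.mem_range.mpr (lt_of_lt_of_le hn.1.2 (Sec12D.ceil_P2pp_le_Nsupp hD))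
  rw [ApolyBar_ite x _ hsub, Hbar16, Finset.mul_sum]
  refine Finset.sum_congr rfl fun n _ => ?_
  rw [conj_psi_eq_inv]
  push_cast
  ring

/-- **`Z(s,ψχ)⁻¹·pref(s)·Σ_{main} dualTerm(s,n) = u(s)·A(𝐜₀;1−s,ψ̄)`**, `c₀ = χ·(·/P″₁)^{β₆}·I_D/0.504·1_{main}`
(`𝓛 ≥ 3`). [cite: Zhang2022LandauSiegel, §12 p.67] -/
theorem inv_Zpc_mul_pref_mul_main (hD : 3 ≤ Real.log D) (s : ℂ) :
    (Zpc χ x s)⁻¹ * (dualPrefactor χ x s *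
        ∑ n ∈ ((Finset.Ico 1 ⌈P2pp D * etaPM D 1⌉₊).filter
          (fun n : ℕ => P1pp D * etaPM D (-1) < n ∧ (n : ℝ) < P2pp D * etaPM D 1)),
          dualTerm χ x s n) =
      ((Zpc χ x s)⁻¹ * Zpc χ x (s + beta6 D) * (((D : ℝ) * bigP D * t0 D : ℝ) : ℂ) ^ beta6 D) *
        ApolyBar x (fun n : ℕ => (if n ∈ ((Finset.Ico 1 ⌈P2pp D * etaPM D 1⌉₊).filter
          (fun n : ℕ => P1pp D * etaPM D (-1) < n ∧ (n : ℝ) < P2pp D * etaPM D 1)) then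
          χ (n : ZMod D) * (((n : ℝ) / P1pp D : ℝ) : ℂ) ^ beta6 D * ((dualInt D n / 0.504 : ℝ) : ℂ)
        else 0)) (1 - s) := by
  have hD1 : 1 ≤ Real.log D := by linarith
  have hsub : ((Finset.Ico 1 ⌈P2pp D * etaPM D 1⌉₊).filter
          (fun n : ℕ => P1pp D * etaPM D (-1) < n ∧ (n : ℝ) < P2pp D * etaPM D 1)) ⊆
      Finset.range (Nsupp D) := by
    intro n hn
    rw [Finset.mem_filter, Finset.mem_Ico] at hn
    exact Finset.mem_range.mpr (lt_of_lt_of_le hn.1.2 (Nat.ceil_mono (P2pp_eta_le_P_div_T_sq hD)))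
  rw [ApolyBar_ite x _ hsub, Finset.mul_sum, Finset.mul_sum, Finset.mul_sum]
  refine Finset.sum_congr rfl fun n hn => ?_
  have hn1 : 1 ≤ n := (Finset.mem_Ico.mp (Finset.mem_filter.mp hn).1).1
  rw [inv_Zpc_mul_pref_mul_dualTerm χ x hD1 hn1 s]

/-- **The pointwise identity behind (12.8)**: on the critical line, with `T = Σ'_n dualTerm(s,n)`,
`pref = Z(s+β₆,ψχ)P₁^{β₆}/0.504`, `u = Z(s,ψχ)⁻¹Z(s+β₆,ψχ)(DPt₀)^{β₆}`,
`Z⁻¹H̃₁₅(s) − H̄₁₆(1−s) = Z⁻¹(H̃₁₅ − pref·T) + Z⁻¹·pref·(tail of T) + (u−1)·A(𝐜₀;1−s,ψ̄) + A(𝐜;1−s,ψ̄)`,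
`c = c₀ − c₁` the dual-side coefficient difference of row G-d42-3 (ii) (`𝓛 ≥ 3`, `𝓛²⁰ ≥ 2`).
[cite: Zhang2022LandauSiegel, §12 (12.8) p.67] -/
theorem pointwise_decomp (hD : 3 ≤ Real.log D) (hκ : 2 ≤ ell D ^ 20) {s : ℂ} (hs : s.re = 1 / 2) :
    (Zpc χ x s)⁻¹ * Htilde15 χ x s - Hbar16 χ x (1 - s) =
      (Zpc χ x s)⁻¹ * (Htilde15 χ x s - dualPrefactor χ x s * ∑' n : ℕ, dualTerm χ x s n) +
      (Zpc χ x s)⁻¹ * (dualPrefactor χ x s *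
        ∑' n : ℕ, (if (n : ℝ) ≤ P1pp D * etaPM D (-1) ∨ P2pp D * etaPM D 1 ≤ n then
          dualTerm χ x s n else 0)) +
      ((Zpc χ x s)⁻¹ * Zpc χ x (s + beta6 D) * (((D : ℝ) * bigP D * t0 D : ℝ) : ℂ) ^ beta6 D - 1) *
        ApolyBar x (fun n : ℕ => (if n ∈ ((Finset.Ico 1 ⌈P2pp D * etaPM D 1⌉₊).filter
          (fun n : ℕ => P1pp D * etaPM D (-1) < n ∧ (n : ℝ) < P2pp D * etaPM D 1)) then
          χ (n : ZMod D) * (((n : ℝ) / P1pp D : ℝ) : ℂ) ^ beta6 D * ((dualInt D n / 0.504 : ℝ) : ℂ)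
        else 0)) (1 - s) +
      ApolyBar x (fun n : ℕ => (if n ∈ ((Finset.Ico 1 ⌈P2pp D * etaPM D 1⌉₊).filter
          (fun n : ℕ => P1pp D * etaPM D (-1) < n ∧ (n : ℝ) < P2pp D * etaPM D 1)) then
          χ (n : ZMod D) * (((n : ℝ) / P1pp D : ℝ) : ℂ) ^ beta6 D * ((dualInt D n / 0.504 : ℝ) : ℂ)
        else 0) -
        (if n ∈ ((Finset.Ico 1 ⌈P2pp D⌉₊).filter (fun n : ℕ => P1pp D < n ∧ (n : ℝ) < P2pp D)) then
          χ (n : ZMod D) * (((n : ℝ) / P1pp D : ℝ) : ℂ) ^ beta6 D *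
            ((Real.log ((n : ℝ) / P1pp D) / Real.log (Skeleton.P1 D) : ℝ) : ℂ)
        else 0)) (1 - s) := by
  have hℓ3 : 3 ≤ ell D := by rw [ell]; exact hD
  have hℓ : 0 < ell D := by linarith
  have hD1 : 1 ≤ Real.log D := by linarith
  have hD0 : 0 < (D : ℝ) := Sec12D.natCast_pos_of_one_le_log hD1
  have key := inv_Zpc_mul_pref_mul_main χ x hD s
  rw [ApolyBar_sub, ← Hbar16_eq_ApolyBar χ x hD, dualTerm_tsum_split χ x hℓ hκ hD0 hs]
  linear_combination key

end Pointwise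

/-! ## §4. Sizes: admissibility of `𝐜₀`, `𝐜`, the Lemma 5.1 factor `u`, and the squared bound -/

section Sizes

variable {D : ℕ} [NeZero D] (χ : DirichletCharacter ℂ D) (x : Chr D)

omit [NeZero D] in
/-- `|I_D(n)| ≤ 0.004` (the integrand `g − g` has absolute value `≤ 1` on `[0.496, 0.5]`).
[cite: Zhang2022LandauSiegel, §12 p.67; §4 (4.1)] -/
theorem abs_dualInt_le (hℓ : 0 < ell D) (n : ℕ) : |dualInt D n| ≤ 0.004 := by
  have h : ‖∫ z in (0.496 : ℝ)..0.5,
      (gW D (bigP D ^ (0.5 : ℝ) * D * t0 D / n) - gW D (bigP D ^ z * D * t0 D / n))‖ ≤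
        1 * |(0.5 : ℝ) - 0.496| :=
    intervalIntegral.norm_integral_le_of_norm_le_const fun z _ => by
      rw [Real.norm_eq_abs]; exact abs_gW_sub_gW_le_one hℓ _ _
  rw [Real.norm_eq_abs, abs_of_pos (by norm_num : (0 : ℝ) < 0.5 - 0.496)] at h
  rw [dualInt]
  linarith

omit [NeZero D] in
/-- **`|c₀(n)| ≤ 1`** (`|χ| ≤ 1`, `|(n/P″₁)^{β₆}| = 1`, `|I_D/0.504| ≤ 0.004/0.504`), `𝓛 ≥ 1`.
[cite: Zhang2022LandauSiegel, §12 p.67] -/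
theorem norm_c0_le (hD : 1 ≤ Real.log D) (n : ℕ) :
    ‖(fun n : ℕ => (if n ∈ ((Finset.Ico 1 ⌈P2pp D * etaPM D 1⌉₊).filter
          (fun n : ℕ => P1pp D * etaPM D (-1) < n ∧ (n : ℝ) < P2pp D * etaPM D 1)) then
          χ (n : ZMod D) * (((n : ℝ) / P1pp D : ℝ) : ℂ) ^ beta6 D * ((dualInt D n / 0.504 : ℝ) : ℂ)
        else 0)) n‖ ≤ 1 := by
  have hℓ : 0 < ell D := by rw [ell]; linarith
  simp only
  split_ifs with hn
  · have hn1 : 1 ≤ n := (Finset.mem_Ico.mp (Finset.mem_filter.mp hn).1).1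
    have hr : 0 < (n : ℝ) / P1pp D := div_pos (by exact_mod_cast hn1) (Sec12D.P1pp_pos hD)
    rw [norm_mul, norm_mul, norm_cpow_beta6 hr, Complex.norm_real, Real.norm_eq_abs, abs_div,
      abs_of_pos (by norm_num : (0 : ℝ) < 0.504)]
    have h1 := DirichletCharacter.norm_le_one χ (n : ZMod D)
    have h2 := abs_dualInt_le hℓ n
    have h3 : |dualInt D n| / 0.504 ≤ 1 := by
      rw [div_le_one (by norm_num)]; linarith
    calc ‖χ (n : ZMod D)‖ * 1 * (|dualInt D n| / 0.504) ≤ 1 * 1 * 1 := by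
          gcongr
      _ = 1 := by norm_num
  · rw [norm_zero]; exact zero_le_one

omit [NeZero D] in
/-- **`|c₁(n)| ≤ 1`** (`0 ≤ log(n/P″₁) ≤ log(P″₂/P″₁) = 0.004 log P` on `P″₁ < n < P″₂`,
`log P₁ = 0.504 log P`), `𝓛 ≥ 1`. [cite: Zhang2022LandauSiegel, §12 p.67] -/
theorem norm_c1_le (hD : 1 ≤ Real.log D) (n : ℕ) :
    ‖(fun n : ℕ => (if n ∈ ((Finset.Ico 1 ⌈P2pp D⌉₊).filter (fun n : ℕ => P1pp D < n ∧ (n : ℝ) < P2pp D)) then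
          χ (n : ZMod D) * (((n : ℝ) / P1pp D : ℝ) : ℂ) ^ beta6 D *
            ((Real.log ((n : ℝ) / P1pp D) / Real.log (Skeleton.P1 D) : ℝ) : ℂ)
        else 0)) n‖ ≤ 1 := by
  have hP1pp := Sec12D.P1pp_pos hD
  have hP : 1 < bigP D := by
    rw [bigP]; exact Real.one_lt_exp_iff.mpr (by rw [ell]; positivity)
  have hlogP : 0 < Real.log (bigP D) := Real.log_pos hP
  simp only
  split_ifs with hn
  · obtain ⟨-, hn1, hn2⟩ := Finset.mem_filter.mp hn
    have hn0 : (0 : ℝ) < n := lt_trans hP1pp hn1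
    have hr : 0 < (n : ℝ) / P1pp D := div_pos hn0 hP1pp
    have hr1 : 1 ≤ (n : ℝ) / P1pp D := by rw [le_div_iff₀ hP1pp]; linarith
    have hlog0 : 0 ≤ Real.log ((n : ℝ) / P1pp D) := Real.log_nonneg hr1
    have hlog1 : Real.log ((n : ℝ) / P1pp D) ≤ 0.004 * Real.log (bigP D) := by
      have h1 : (n : ℝ) / P1pp D ≤ P2pp D / P1pp D :=
        div_le_div_of_nonneg_right hn2.le hP1pp.le
      rw [Sec12D.P2pp_div_P1pp hD] at h1
      calc Real.log ((n : ℝ) / P1pp D) ≤ Real.log (bigP D ^ (0.004 : ℝ)) := Real.log_le_log hr h1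
        _ = 0.004 * Real.log (bigP D) := Real.log_rpow (by linarith) _
    rw [norm_mul, norm_mul, norm_cpow_beta6 hr, Complex.norm_real, Real.norm_eq_abs,
      Sec12D.log_P1_eq_mul, abs_div, abs_of_nonneg hlog0,
      abs_of_pos (by positivity : (0 : ℝ) < 0.504 * Real.log (bigP D))]
    have h1 := DirichletCharacter.norm_le_one χ (n : ZMod D)
    have h3 : Real.log ((n : ℝ) / P1pp D) / (0.504 * Real.log (bigP D)) ≤ 1 := by
      rw [div_le_one (by positivity)]; nlinarith
    calc ‖χ (n : ZMod D)‖ * 1 * (Real.log ((n : ℝ) / P1pp D) / (0.504 * Real.log (bigP D)))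
        ≤ 1 * 1 * 1 := by gcongr
      _ = 1 := by norm_num
  · rw [norm_zero]; exact zero_le_one

omit [NeZero D] in
/-- **`𝐜₀` is admissible for (7.2) with `B = 1`** (support `< P″₂η₊ ≤ PT⁻²`), `𝓛 ≥ 3`.
[cite: Zhang2022LandauSiegel, §7 (7.2); §12 p.67] -/
theorem adm72_c0 (hD : 3 ≤ Real.log D) :
    Adm72 D 1 (fun n : ℕ => (if n ∈ ((Finset.Ico 1 ⌈P2pp D * etaPM D 1⌉₊).filter
          (fun n : ℕ => P1pp D * etaPM D (-1) < n ∧ (n : ℝ) < P2pp D * etaPM D 1)) then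
          χ (n : ZMod D) * (((n : ℝ) / P1pp D : ℝ) : ℂ) ^ beta6 D * ((dualInt D n / 0.504 : ℝ) : ℂ)
        else 0)) := by
  refine ⟨norm_c0_le χ (by linarith), fun n hn => ?_⟩
  simp only
  rw [if_neg]
  intro hm
  have h := (Finset.mem_filter.mp hm).2.2
  linarith [P2pp_eta_le_P_div_T_sq hD]

omit [NeZero D] in
/-- **`𝐜 = 𝐜₀ − 𝐜₁` is admissible for (7.2) with `B = 2`**, `𝓛 ≥ 3`.
[cite: Zhang2022LandauSiegel, §7 (7.2); §12 p.67] -/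
theorem adm72_cSeq (hD : 3 ≤ Real.log D) :
    Adm72 D 2 (fun n : ℕ => (if n ∈ ((Finset.Ico 1 ⌈P2pp D * etaPM D 1⌉₊).filter
          (fun n : ℕ => P1pp D * etaPM D (-1) < n ∧ (n : ℝ) < P2pp D * etaPM D 1)) then
          χ (n : ZMod D) * (((n : ℝ) / P1pp D : ℝ) : ℂ) ^ beta6 D * ((dualInt D n / 0.504 : ℝ) : ℂ)
        else 0) -
        (if n ∈ ((Finset.Ico 1 ⌈P2pp D⌉₊).filter (fun n : ℕ => P1pp D < n ∧ (n : ℝ) < P2pp D)) then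
          χ (n : ZMod D) * (((n : ℝ) / P1pp D : ℝ) : ℂ) ^ beta6 D *
            ((Real.log ((n : ℝ) / P1pp D) / Real.log (Skeleton.P1 D) : ℝ) : ℂ)
        else 0)) := by
  have hD1 : 1 ≤ Real.log D := by linarith
  have hℓ : 0 < ell D := by rw [ell]; linarith
  have hη : 1 ≤ etaPM D 1 := by rw [etaPM, one_mul]; exact Real.one_le_exp (by positivity)
  refine ⟨fun n => ?_, fun n hn => ?_⟩
  · have h0 := norm_c0_le χ hD1 n
    have h1 := norm_c1_le χ hD1 n
    simp only at h0 h1 ⊢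
    exact le_trans (norm_sub_le _ _) (by linarith)
  · have hP2 := P2pp_eta_le_P_div_T_sq hD
    have hP2' : P2pp D ≤ bigP D / bigT D ^ 2 :=
      le_trans (le_mul_of_one_le_right (Sec12D.P2pp_pos hD1).le hη) hP2
    simp only
    rw [if_neg, if_neg, sub_zero]
    · intro hm
      have h := (Finset.mem_filter.mp hm).2.2
      linarith
    · intro hm
      have h := (Finset.mem_filter.mp hm).2.2
      linarith

omit [NeZero D] in
/-- On the critical line `|A(𝐚;1−s,ψ̄)| = |A(𝐚̄;s,ψ)|` (`A(𝐚;1−s,ψ̄) = conj A(𝐚̄;s,ψ)`).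
[cite: Zhang2022LandauSiegel, §8 (8.7)–(8.8)] -/
theorem norm_ApolyBar_one_sub (a : ℕ → ℂ) {s : ℂ} (hs : s.re = 1 / 2) :
    ‖ApolyBar x a (1 - s)‖ = ‖Apoly x (fun n => conj (a n)) s‖ := by
  have h := ApolyBar_conj_eq x (fun n => conj (a n)) hs
  have e : (fun n => conj ((fun n => conj (a n)) n)) = a := by funext n; simp
  rw [e] at h
  rw [h, RCLike.norm_conj]

/-- **The Lemma 5.1 factor**: `u(s) = Z(s,ψχ)⁻¹Z(s+β₆,ψχ)(DPt₀)^{β₆}` satisfies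
`|u − 1| ≤ C₅₁·(3α/2)·𝓛⁻⁶⁸` on the critical line in the window (`|Z(s,ψχ)| = 1`, (5.4) at modulus
`DPt₀` with `iv = β₆`, `Skeleton.lemma51_holds`), for all large `D`.
[cite: Zhang2022LandauSiegel, §5 Lemma 5.1 (5.4); §12 p.67] -/
theorem norm_u_sub_one_le : ∃ C : ℝ, 0 ≤ C ∧ ForAllLarge fun D _ χ => ∀ x : Chr D, ∀ s : ℂ,
    s.re = 1 / 2 → |s.im - 2 * π * t0 D| < ell1 D →
      ‖(Zpc χ x s)⁻¹ * Zpc χ x (s + beta6 D) * (((D : ℝ) * bigP D * t0 D : ℝ) : ℂ) ^ beta6 D - 1‖ ≤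
        C * (3 * alpha D / 2) * (ell D ^ 68)⁻¹ := by
  obtain ⟨C, D₀, h51⟩ := lemma51_holds
  refine ⟨|C|, abs_nonneg C, max D₀ ⌈Real.exp 3⌉₊, fun D _ χ hD hq hp x s hs ht => ?_⟩
  have hD₀ : D₀ ≤ D := le_trans (le_max_left _ _) hD
  have hℓ3 : 3 ≤ ell D := le_ell_of_ceil_exp_le (le_trans (le_max_right _ _) hD)
  have hℓ : 0 < ell D := by linarith
  have hD1 : 1 ≤ Real.log D := by rw [← ell]; linarith
  have hD3 : 3 ≤ D := by
    have h3 : (3 : ℝ) ≤ Real.exp 3 := by have := Real.add_one_le_exp (3 : ℝ); linarith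
    have : (3 : ℝ) ≤ (D : ℝ) :=
      le_trans (le_trans h3 (Nat.le_ceil _)) (by exact_mod_cast le_trans (le_max_right _ _) hD)
    exact_mod_cast this
  have hα : alpha D = π / ell D ^ 9 := by rw [alpha, bigP, Real.log_exp]
  have hα0 : 0 < alpha D := by rw [hα]; positivity
  -- the range of Lemma 5.1 and the size of `v = 3α/2`
  have hrange : InRange51 D s := by
    refine ⟨?_, by linarith⟩
    rw [hs, sub_self, abs_zero]; exact hα0.le
  have hv0 : (3 * alpha D / 2 : ℝ) ≠ 0 := by positivity
  have hv : |3 * alpha D / 2| < ell D ^ 20 := by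
    rw [abs_of_pos (by positivity), hα]
    have h9 : π / ell D ^ 9 ≤ π := by
      apply div_le_self Real.pi_pos.le (one_le_pow₀ (by linarith))
    have h20 : (3 : ℝ) ^ 20 ≤ ell D ^ 20 := pow_le_pow_left₀ (by norm_num) hℓ3 20
    nlinarith [Real.pi_lt_four]
  obtain ⟨-, -, -, h4⟩ := h51 D χ hD₀ hq hp x s hrange (3 * alpha D / 2) hv0 hv
  -- `iv = β₆`
  have hvI : ((3 * alpha D / 2 : ℝ) : ℂ) * I = beta6 D := (beta6_eq_mul_I D).symm
  rw [hvI] at h4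
  have hβ : ‖beta6 D‖ = 3 * alpha D / 2 := by
    rw [beta6_eq_mul_I, norm_mul, Complex.norm_I, mul_one, Complex.norm_real, Real.norm_eq_abs,
      abs_of_pos (by positivity)]
  have hβ0 : beta6 D ≠ 0 := by
    intro h; rw [h, norm_zero] at hβ; exact hv0 hβ.symm
  have h5 : ‖Zpc χ x (s + beta6 D) - Zpc χ x s * (((D : ℝ) * bigP D * t0 D : ℝ) : ℂ) ^ (-beta6 D)‖ ≤
      C * (ell D ^ 68)⁻¹ * (3 * alpha D / 2) := by
    have := h4
    rw [norm_div, div_le_iff₀ (norm_pos_iff.mpr hβ0), hβ] at this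
    exact this
  -- `|Z(s)| = 1`, `|R^{β₆}| = 1`
  have hprim := psiChiPrimitive_holds D χ x hD3 hp
  have him : 0 < s.im := by
    have h1 : ell1 D ≤ 2 * π * t0 D := by
      rw [ell1, t0]
      have h2 : ell D ^ 405 ≤ ell D ^ 519 := pow_le_pow_right₀ (by linarith) (by norm_num)
      nlinarith [Real.pi_gt_three, pow_pos hℓ 519]
    have h3 := (abs_lt.mp ht).1
    linarith
  have hZ1 : ‖Zpc χ x s‖ = 1 := norm_Zpc_eq_one χ hprim hs him
  have hZ0 : Zpc χ x s ≠ 0 := by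
    intro h; rw [h, norm_zero] at hZ1; exact one_ne_zero hZ1.symm
  have hR0 : 0 < (D : ℝ) * bigP D * t0 D :=
    mul_pos (mul_pos (Sec12D.natCast_pos_of_one_le_log hD1) (bigP_pos D)) (pow_pos hℓ 519)
  have hRn : ‖(((D : ℝ) * bigP D * t0 D : ℝ) : ℂ) ^ beta6 D‖ = 1 := norm_cpow_beta6 hR0
  have hRne : (((D : ℝ) * bigP D * t0 D : ℝ) : ℂ) ^ beta6 D ≠ 0 := by
    intro h; rw [h, norm_zero] at hRn; exact one_ne_zero hRn.symm
  -- `u − 1 = Z⁻¹·R^{β₆}·(Z(s+β₆) − Z(s)R^{−β₆})`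
  set Z := Zpc χ x s
  set Z6 := Zpc χ x (s + beta6 D)
  set Rb := (((D : ℝ) * bigP D * t0 D : ℝ) : ℂ) ^ beta6 D
  have hneg : (((D : ℝ) * bigP D * t0 D : ℝ) : ℂ) ^ (-beta6 D) = Rb⁻¹ := Complex.cpow_neg _ _
  rw [hneg] at h5
  have hid : Z⁻¹ * Z6 * Rb - 1 = Z⁻¹ * Rb * (Z6 - Z * Rb⁻¹) := by
    field_simp
  rw [hid, norm_mul, norm_mul, norm_inv, hZ1, hRn, inv_one, one_mul, one_mul]
  calc ‖Z6 - Z * Rb⁻¹‖ ≤ C * (ell D ^ 68)⁻¹ * (3 * alpha D / 2) := h5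
    _ ≤ |C| * (ell D ^ 68)⁻¹ * (3 * alpha D / 2) := by gcongr; exact le_abs_self C
    _ = |C| * (3 * alpha D / 2) * (ell D ^ 68)⁻¹ := by ring

omit [NeZero D] in
/-- `(a+b+c+d+e)² ≤ 5(a²+b²+c²+d²+e²)` (Cauchy's inequality with five terms). [folklore] -/
private theorem sq_add5_le (a b c d e : ℝ) :
    (a + b + c + d + e) ^ 2 ≤ 5 * (a ^ 2 + b ^ 2 + c ^ 2 + d ^ 2 + e ^ 2) := by
  nlinarith [sq_nonneg (a - b), sq_nonneg (a - c), sq_nonneg (a - d), sq_nonneg (a - e),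
    sq_nonneg (b - c), sq_nonneg (b - d), sq_nonneg (b - e), sq_nonneg (c - d),
    sq_nonneg (c - e), sq_nonneg (d - e)]

/-- **The squared pointwise bound**: on the critical line, with `|Z(s,ψχ)| = 1`, the approximate
functional equation (error `C₁(E + e₁)`), the tails (`τ₂`), `|u−1| ≤ κ`,
`|Z⁻¹H̃₁₅ − H̄₁₆|² ≤ 5(C₁²E² + C₁²e₁² + τ₂² + κ²|A(𝐜̄₀;s,ψ)|² + |A(𝐜̄;s,ψ)|²)`.
[cite: Zhang2022LandauSiegel, §12 (12.8) p.67] -/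
theorem pointwise_sq_bound (hD : 3 ≤ Real.log D) (hκ : 2 ≤ ell D ^ 20) {s : ℂ} (hs : s.re = 1 / 2)
    (hZ1 : ‖Zpc χ x s‖ = 1) {C₁ E e₁ τ₂ κ : ℝ}
    (hFE : ‖Htilde15 χ x s - dualPrefactor χ x s * ∑' n : ℕ, dualTerm χ x s n‖ ≤ C₁ * (E + e₁))
    (hT : ‖dualPrefactor χ x s *
        ∑' n : ℕ, (if (n : ℝ) ≤ P1pp D * etaPM D (-1) ∨ P2pp D * etaPM D 1 ≤ n then
          dualTerm χ x s n else 0)‖ ≤ τ₂)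
    (hu : ‖(Zpc χ x s)⁻¹ * Zpc χ x (s + beta6 D) * (((D : ℝ) * bigP D * t0 D : ℝ) : ℂ) ^ beta6 D - 1‖
      ≤ κ) :
    ‖(Zpc χ x s)⁻¹ * Htilde15 χ x s - Hbar16 χ x (1 - s)‖ ^ 2 ≤
      5 * ((C₁ * E) ^ 2 + (C₁ * e₁) ^ 2 + τ₂ ^ 2 +
        (κ * ‖Apoly x (fun n : ℕ => conj (if n ∈ ((Finset.Ico 1 ⌈P2pp D * etaPM D 1⌉₊).filter
          (fun n : ℕ => P1pp D * etaPM D (-1) < n ∧ (n : ℝ) < P2pp D * etaPM D 1)) then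
          χ (n : ZMod D) * (((n : ℝ) / P1pp D : ℝ) : ℂ) ^ beta6 D * ((dualInt D n / 0.504 : ℝ) : ℂ)
        else 0)) s‖) ^ 2 +
        ‖Apoly x (fun n : ℕ => conj ((if n ∈ ((Finset.Ico 1 ⌈P2pp D * etaPM D 1⌉₊).filter
          (fun n : ℕ => P1pp D * etaPM D (-1) < n ∧ (n : ℝ) < P2pp D * etaPM D 1)) then
          χ (n : ZMod D) * (((n : ℝ) / P1pp D : ℝ) : ℂ) ^ beta6 D * ((dualInt D n / 0.504 : ℝ) : ℂ)
        else 0) -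
        (if n ∈ ((Finset.Ico 1 ⌈P2pp D⌉₊).filter (fun n : ℕ => P1pp D < n ∧ (n : ℝ) < P2pp D)) then
          χ (n : ZMod D) * (((n : ℝ) / P1pp D : ℝ) : ℂ) ^ beta6 D *
            ((Real.log ((n : ℝ) / P1pp D) / Real.log (Skeleton.P1 D) : ℝ) : ℂ)
        else 0))) s‖ ^ 2) := by
  have hZinv : ‖(Zpc χ x s)⁻¹‖ = 1 := by rw [norm_inv, hZ1, inv_one]
  rw [pointwise_decomp χ x hD hκ hs]
  set v₁ := (Zpc χ x s)⁻¹ * (Htilde15 χ x s - dualPrefactor χ x s * ∑' n : ℕ, dualTerm χ x s n)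
  set v₂ := (Zpc χ x s)⁻¹ * (dualPrefactor χ x s *
    ∑' n : ℕ, (if (n : ℝ) ≤ P1pp D * etaPM D (-1) ∨ P2pp D * etaPM D 1 ≤ n then
      dualTerm χ x s n else 0))
  set A₀ := ApolyBar x (fun n : ℕ => (if n ∈ ((Finset.Ico 1 ⌈P2pp D * etaPM D 1⌉₊).filter
          (fun n : ℕ => P1pp D * etaPM D (-1) < n ∧ (n : ℝ) < P2pp D * etaPM D 1)) then
          χ (n : ZMod D) * (((n : ℝ) / P1pp D : ℝ) : ℂ) ^ beta6 D * ((dualInt D n / 0.504 : ℝ) : ℂ)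
        else 0)) (1 - s) with hA₀
  set R := ApolyBar x (fun n : ℕ => (if n ∈ ((Finset.Ico 1 ⌈P2pp D * etaPM D 1⌉₊).filter
          (fun n : ℕ => P1pp D * etaPM D (-1) < n ∧ (n : ℝ) < P2pp D * etaPM D 1)) then
          χ (n : ZMod D) * (((n : ℝ) / P1pp D : ℝ) : ℂ) ^ beta6 D * ((dualInt D n / 0.504 : ℝ) : ℂ)
        else 0) -
        (if n ∈ ((Finset.Ico 1 ⌈P2pp D⌉₊).filter (fun n : ℕ => P1pp D < n ∧ (n : ℝ) < P2pp D)) then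
          χ (n : ZMod D) * (((n : ℝ) / P1pp D : ℝ) : ℂ) ^ beta6 D *
            ((Real.log ((n : ℝ) / P1pp D) / Real.log (Skeleton.P1 D) : ℝ) : ℂ)
        else 0)) (1 - s) with hR
  set w := (Zpc χ x s)⁻¹ * Zpc χ x (s + beta6 D) * (((D : ℝ) * bigP D * t0 D : ℝ) : ℂ) ^ beta6 D - 1
  have h1 : ‖v₁‖ ≤ C₁ * E + C₁ * e₁ := by
    have := norm_mul_le (Zpc χ x s)⁻¹
      (Htilde15 χ x s - dualPrefactor χ x s * ∑' n : ℕ, dualTerm χ x s n)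
    rw [hZinv, one_mul] at this
    linarith
  have h2 : ‖v₂‖ ≤ τ₂ := by
    have := norm_mul_le (Zpc χ x s)⁻¹ (dualPrefactor χ x s *
      ∑' n : ℕ, (if (n : ℝ) ≤ P1pp D * etaPM D (-1) ∨ P2pp D * etaPM D 1 ≤ n then
        dualTerm χ x s n else 0))
    rw [hZinv, one_mul] at this
    linarith
  have h3 : ‖w * A₀‖ ≤ κ * ‖A₀‖ := by
    rw [norm_mul]; exact mul_le_mul_of_nonneg_right hu (norm_nonneg _)
  have hA₀' : ‖A₀‖ = ‖Apoly x (fun n : ℕ => conj (if n ∈ ((Finset.Ico 1 ⌈P2pp D * etaPM D 1⌉₊).filter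
          (fun n : ℕ => P1pp D * etaPM D (-1) < n ∧ (n : ℝ) < P2pp D * etaPM D 1)) then
          χ (n : ZMod D) * (((n : ℝ) / P1pp D : ℝ) : ℂ) ^ beta6 D * ((dualInt D n / 0.504 : ℝ) : ℂ)
        else 0)) s‖ :=
    norm_ApolyBar_one_sub x _ hs
  have hR' : ‖R‖ = ‖Apoly x (fun n : ℕ => conj ((if n ∈ ((Finset.Ico 1 ⌈P2pp D * etaPM D 1⌉₊).filter
          (fun n : ℕ => P1pp D * etaPM D (-1) < n ∧ (n : ℝ) < P2pp D * etaPM D 1)) then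
          χ (n : ZMod D) * (((n : ℝ) / P1pp D : ℝ) : ℂ) ^ beta6 D * ((dualInt D n / 0.504 : ℝ) : ℂ)
        else 0) -
        (if n ∈ ((Finset.Ico 1 ⌈P2pp D⌉₊).filter (fun n : ℕ => P1pp D < n ∧ (n : ℝ) < P2pp D)) then
          χ (n : ZMod D) * (((n : ℝ) / P1pp D : ℝ) : ℂ) ^ beta6 D *
            ((Real.log ((n : ℝ) / P1pp D) / Real.log (Skeleton.P1 D) : ℝ) : ℂ)
        else 0))) s‖ := norm_ApolyBar_one_sub x _ hs
  have hsum : ‖v₁ + v₂ + w * A₀ + R‖ ≤ C₁ * E + C₁ * e₁ + τ₂ + κ * ‖A₀‖ + ‖R‖ := by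
    have e1 := norm_add_le (v₁ + v₂ + w * A₀) R
    have e2 := norm_add_le (v₁ + v₂) (w * A₀)
    have e3 := norm_add_le v₁ v₂
    linarith
  have h0 : 0 ≤ ‖v₁ + v₂ + w * A₀ + R‖ := norm_nonneg _
  rw [← hA₀', ← hR']
  calc ‖v₁ + v₂ + w * A₀ + R‖ ^ 2 ≤ (C₁ * E + C₁ * e₁ + τ₂ + κ * ‖A₀‖ + ‖R‖) ^ 2 :=
        pow_le_pow_left₀ h0 hsum 2
    _ ≤ 5 * ((C₁ * E) ^ 2 + (C₁ * e₁) ^ 2 + τ₂ ^ 2 + (κ * ‖A₀‖) ^ 2 + ‖R‖ ^ 2) := sq_add5_le _ _ _ _ _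

end Sizes

/-! ## §5. The reduction of (12.8) -/

section Reduction

/-- `y·e^{−y} ≤ 1` for `y ≥ 0`. [folklore] -/
private theorem mul_exp_neg_le_one {y : ℝ} (hy : 0 ≤ y) : y * Real.exp (-y) ≤ 1 := by
  have h1 : y + 1 ≤ Real.exp y := Real.add_one_le_exp y
  have h2 : Real.exp (-y) * Real.exp y = 1 := by rw [← Real.exp_add]; simp
  nlinarith [Real.exp_pos (-y), Real.exp_pos y]

/-- For `D ≥ ⌈e^M⌉` with `M ≥ 4`: the standing sizes `𝓛 ≥ M`, `𝓛 ≥ 4`, `log D ≥ 3`, `D ≥ 3`, `𝓛²⁰ ≥ 2`.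
[cite: Zhang2022LandauSiegel, §2 (2.1)] -/
private theorem sizes_of_le {M : ℝ} (hM : 4 ≤ M) {D : ℕ} (hD : ⌈Real.exp M⌉₊ ≤ D) :
    M ≤ ell D ∧ 4 ≤ ell D ∧ 3 ≤ Real.log D ∧ 3 ≤ D ∧ 2 ≤ ell D ^ 20 := by
  have hM' := le_ell_of_ceil_exp_le hD
  have h4 : 4 ≤ ell D := le_trans hM hM'
  have hlog : 3 ≤ Real.log D := by rw [← ell]; linarith
  have hD3 : 3 ≤ D := by
    have h3 : (3 : ℝ) ≤ Real.exp M := by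
      have := Real.add_one_le_exp M; linarith
    have : (3 : ℝ) ≤ (D : ℝ) := le_trans (le_trans h3 (Nat.le_ceil _)) (by exact_mod_cast hD)
    exact_mod_cast this
  refine ⟨hM', h4, hlog, hD3, ?_⟩
  calc (2 : ℝ) ≤ 4 ^ 20 := by norm_num
    _ ≤ ell D ^ 20 := pow_le_pow_left₀ (by norm_num) h4 20

/-- The budget of an exponentially small term against the total mass: if `20(C²+1)K ≤ cεa₀𝓛` then
`5(C·e^{−c𝓛¹⁰})²·K𝓛⁹·𝔓 ≤ (ε/8)a₀𝔓`. [cite: Zhang2022LandauSiegel, §11 p.64 (absorption of `O(ε)²`)] -/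
private theorem exp_budget {C K c ε a₀ L P : ℝ} (hc : 0 < c) (hε : 0 < ε) (ha : 0 < a₀) (hK : 0 < K)
    (hL : 0 < L) (hP : 0 ≤ P) (hM : 20 * (C ^ 2 + 1) * K ≤ c * ε * a₀ * L) :
    5 * ((C * Real.exp (-c * L ^ 10)) ^ 2) * (K * L ^ 9 * P) ≤ ε / 8 * a₀ * P := by
  set e : ℝ := Real.exp (-c * L ^ 10) with he
  have hy : 0 ≤ 2 * c * L ^ 10 := by positivity
  have hkey : (2 * c * L ^ 10) * e ^ 2 ≤ 1 := by
    have : e ^ 2 = Real.exp (-(2 * c * L ^ 10)) := by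
      rw [he, sq, ← Real.exp_add]; ring_nf
    rw [this]; exact mul_exp_neg_le_one hy
  have h1 : 5 * ((C * e) ^ 2) * (K * L ^ 9) ≤ (c * ε * a₀ / 4) * L ^ 10 * e ^ 2 := by
    have e1 : 5 * ((C * e) ^ 2) * (K * L ^ 9) = (5 * C ^ 2 * K) * (L ^ 9 * e ^ 2) := by ring
    rw [e1]
    have h5 : 5 * C ^ 2 * K ≤ 5 * (C ^ 2 + 1) * K := by nlinarith
    calc (5 * C ^ 2 * K) * (L ^ 9 * e ^ 2) ≤ (5 * (C ^ 2 + 1) * K) * (L ^ 9 * e ^ 2) := by gcongr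
      _ ≤ (c * ε * a₀ * L / 4) * (L ^ 9 * e ^ 2) := by gcongr; linarith
      _ = (c * ε * a₀ / 4) * L ^ 10 * e ^ 2 := by ring
  have h2 : (c * ε * a₀ / 4) * L ^ 10 * e ^ 2 ≤ ε / 8 * a₀ := by
    have e2 : (c * ε * a₀ / 4) * L ^ 10 * e ^ 2 = (ε * a₀ / 8) * ((2 * c * L ^ 10) * e ^ 2) := by
      ring
    rw [e2]
    calc (ε * a₀ / 8) * ((2 * c * L ^ 10) * e ^ 2) ≤ (ε * a₀ / 8) * 1 := by gcongr
      _ = ε / 8 * a₀ := by ring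
  calc 5 * ((C * e) ^ 2) * (K * L ^ 9 * P) = (5 * ((C * e) ^ 2) * (K * L ^ 9)) * P := by ring
    _ ≤ (ε / 8 * a₀) * P := mul_le_mul_of_nonneg_right (h1.trans h2) hP
    _ = ε / 8 * a₀ * P := by ring

/-- The budget of the Lemma 5.1 term against the crude mean square: with `κ = C₅(3α/2)𝓛⁻⁶⁸`,
`α = π/𝓛⁹`, if `45π²(C₅²+1)K ≤ εa₀𝓛` (and `𝓛 ≥ 1`) then `5κ²·K𝓛⁸¹𝔓 ≤ (ε/4)a₀𝔓`.
[cite: Zhang2022LandauSiegel, §5 (5.4); §12 p.67] -/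
private theorem kappa_budget {C₅ K ε a₀ L P : ℝ} (hε : 0 < ε) (ha : 0 < a₀) (hK : 0 < K)
    (hL : 1 ≤ L) (hP : 0 ≤ P) (hM : 45 * π ^ 2 * (C₅ ^ 2 + 1) * K ≤ ε * a₀ * L) :
    5 * (C₅ * (3 * (π / L ^ 9) / 2) * (L ^ 68)⁻¹) ^ 2 * (K * L ^ 81 * P) ≤ ε / 4 * a₀ * P := by
  have hL0 : 0 < L := by linarith
  have hκ2 : (C₅ * (3 * (π / L ^ 9) / 2) * (L ^ 68)⁻¹) ^ 2 =
      C₅ ^ 2 * (9 * π ^ 2 / 4) * (L ^ 154)⁻¹ := by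
    ring
  have h73 : L ^ 81 * (L ^ 154)⁻¹ ≤ L⁻¹ := by
    rw [show L ^ 81 * (L ^ 154)⁻¹ = (L ^ 73)⁻¹ by field_simp]
    exact inv_anti₀ hL0 (by
      calc L = L ^ 1 := (pow_one _).symm
        _ ≤ L ^ 73 := pow_le_pow_right₀ hL (by norm_num))
  have h1 : 5 * (C₅ * (3 * (π / L ^ 9) / 2) * (L ^ 68)⁻¹) ^ 2 * (K * L ^ 81) ≤ ε / 4 * a₀ := by
    rw [hκ2]
    have e : 5 * (C₅ ^ 2 * (9 * π ^ 2 / 4) * (L ^ 154)⁻¹) * (K * L ^ 81) =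
        (45 * π ^ 2 / 4 * C₅ ^ 2 * K) * (L ^ 81 * (L ^ 154)⁻¹) := by ring
    rw [e]
    have h5 : 45 * π ^ 2 / 4 * C₅ ^ 2 * K ≤ (ε * a₀ * L) / 4 := by
      nlinarith [sq_nonneg C₅, Real.pi_pos, sq_nonneg π, mul_pos (mul_pos hε ha) hL0,
        mul_nonneg (sq_nonneg π) hK.le]
    calc (45 * π ^ 2 / 4 * C₅ ^ 2 * K) * (L ^ 81 * (L ^ 154)⁻¹)
        ≤ ((ε * a₀ * L) / 4) * L⁻¹ := by gcongr
      _ = ε / 4 * a₀ := by field_simp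
  calc 5 * (C₅ * (3 * (π / L ^ 9) / 2) * (L ^ 68)⁻¹) ^ 2 * (K * L ^ 81 * P)
      = (5 * (C₅ * (3 * (π / L ^ 9) / 2) * (L ^ 68)⁻¹) ^ 2 * (K * L ^ 81)) * P := by ring
    _ ≤ (ε / 4 * a₀) * P := mul_le_mul_of_nonneg_right h1 hP
    _ = ε / 4 * a₀ * P := by ring

/-- **(12.8) from Lemma 8.1, Proposition 7.1, the `H̃₁₅` approximate functional equation and ONE
unprinted window estimate** — the cell's repaired deduction `Ded128R` of row G-d42-3, proved. The
approximate functional equation is taken in the repaired form (error `C·(E(s+β₆,ψ) + e^{−c𝓛¹⁰})`,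
cf. Lemma 11.2 → `Section11AFE.Step11u024e`; the printed `Typed.Sec12A.Htilde15ApproxFE` implies it);
`hS` is «`S_j(𝐜̄,𝐜) = o(α𝔞)`» for the dual-side coefficient difference
`c(n) = χ(n)(n/P″₁)^{β₆}[I_D(n)/0.504·1_{P″₁η₋<n<P″₂η₊} − log(n/P″₁)/log P₁·1_{P″₁<n<P″₂}]` (row
G-d42-3 (ii) verbatim, over the index sets of `Typed.Sec12A.Htilde15`/`Hbar16`; `I_D = dualInt`).
Discharged inside: the tails (`dualTailsSmall_holds`), the shifted `E₂` mean square
(`Section12E2ShiftMeanSquare`), Lemma 5.1 (5.4) (`norm_u_sub_one_le`), the total mass and the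
crude mean square (`Section11Deductions.totalMass_le`, `DiscreteMeanSquare.meanSq_le_polylog`),
`𝔞 ≫ 1`, Prop. 2.2 (i), Lemma 2.3, `ψχ` primitive. The integral identity `IntGDual` is not used
here: it is what makes `c` small in the bulk, i.e. it enters the proof of `hS`.
[cite: Zhang2022LandauSiegel, §12 (12.8) p.67, tex L3440–L3443] -/
theorem eq128_of_sj_small (c' : ℝ) (h22 : Prop22i) (h23 : Lemma23 c') (h81 : Lemma81 c')
    (h71 : Prop71 c')
    (hFE : ∃ c : ℝ, 0 < c ∧ ∃ C : ℝ, ForAllLarge fun D _ χ => AssumptionA D χ → ∀ x : Chr D,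
      ∀ s : ℂ, s.re = 1 / 2 → |s.im - 2 * π * t0 D| < ell1 D →
        ‖Htilde15 χ x s - dualPrefactor χ x s * ∑' n : ℕ, dualTerm χ x s n‖ ≤
          C * (E2main χ x (s + beta6 D) + Real.exp (-c * ell D ^ 10)))
    (hS : ∀ ε : ℝ, 0 < ε → ForAllLarge fun D _ χ => AssumptionA D χ →
      ∀ j ∈ ({1, 2, 3} : Finset ℕ),
        ‖Sj c' D j
            (fun n : ℕ => conj ((if n ∈ ((Finset.Ico 1 ⌈P2pp D * etaPM D 1⌉₊).filter
          (fun n : ℕ => P1pp D * etaPM D (-1) < n ∧ (n : ℝ) < P2pp D * etaPM D 1)) then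
          χ (n : ZMod D) * (((n : ℝ) / P1pp D : ℝ) : ℂ) ^ beta6 D * ((dualInt D n / 0.504 : ℝ) : ℂ)
        else 0) -
        (if n ∈ ((Finset.Ico 1 ⌈P2pp D⌉₊).filter (fun n : ℕ => P1pp D < n ∧ (n : ℝ) < P2pp D)) then
          χ (n : ZMod D) * (((n : ℝ) / P1pp D : ℝ) : ℂ) ^ beta6 D *
            ((Real.log ((n : ℝ) / P1pp D) / Real.log (Skeleton.P1 D) : ℝ) : ℂ)
        else 0)))
            (fun n : ℕ => (if n ∈ ((Finset.Ico 1 ⌈P2pp D * etaPM D 1⌉₊).filter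
          (fun n : ℕ => P1pp D * etaPM D (-1) < n ∧ (n : ℝ) < P2pp D * etaPM D 1)) then
          χ (n : ZMod D) * (((n : ℝ) / P1pp D : ℝ) : ℂ) ^ beta6 D * ((dualInt D n / 0.504 : ℝ) : ℂ)
        else 0) -
        (if n ∈ ((Finset.Ico 1 ⌈P2pp D⌉₊).filter (fun n : ℕ => P1pp D < n ∧ (n : ℝ) < P2pp D)) then
          χ (n : ZMod D) * (((n : ℝ) / P1pp D : ℝ) : ℂ) ^ beta6 D *
            ((Real.log ((n : ℝ) / P1pp D) / Real.log (Skeleton.P1 D) : ℝ) : ℂ)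
        else 0))‖ ≤
          ε * alpha D * frakA χ) :
    Eq128 c' := by
  intro ε hε
  obtain ⟨a₀, ha₀, hA⟩ := frakALowerBound_holds
  obtain ⟨c₁, hc₁, C₁, hFE⟩ := hFE
  obtain ⟨c₂, hc₂, C₂, hT⟩ := dualTailsSmall_holds
  obtain ⟨C₅, hC₅, hU⟩ := norm_u_sub_one_le
  obtain ⟨Km, hKm, hMass⟩ := totalMass_le c' h23 h22 h81 h71
  obtain ⟨Kp, hKp, hPoly⟩ := meanSq_le_polylog c' h23 h22 h81 h71
  -- the shifted `E₂` mean square at `ε₁`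
  set ε₁ : ℝ := ε / (20 * (C₁ ^ 2 + 1)) with hε₁def
  have hε₁ : 0 < ε₁ := by positivity
  have hE2 := Section12E2ShiftMeanSquare.e2ShiftMeanSq_of_lemma81_prop71 c' h23 h22 h81 h71
    frakALowerBound_holds ε₁ hε₁
  -- the window term via the generic fine reduction at `ε/20`
  have hadm : ForAllLarge fun D _ χ => Adm72 D 2 (fun n : ℕ => conj ((if n ∈ ((Finset.Ico 1 ⌈P2pp D * etaPM D 1⌉₊).filter
          (fun n : ℕ => P1pp D * etaPM D (-1) < n ∧ (n : ℝ) < P2pp D * etaPM D 1)) then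
          χ (n : ZMod D) * (((n : ℝ) / P1pp D : ℝ) : ℂ) ^ beta6 D * ((dualInt D n / 0.504 : ℝ) : ℂ)
        else 0) -
        (if n ∈ ((Finset.Ico 1 ⌈P2pp D⌉₊).filter (fun n : ℕ => P1pp D < n ∧ (n : ℝ) < P2pp D)) then
          χ (n : ZMod D) * (((n : ℝ) / P1pp D : ℝ) : ℂ) ^ beta6 D *
            ((Real.log ((n : ℝ) / P1pp D) / Real.log (Skeleton.P1 D) : ℝ) : ℂ)
        else 0))) :=
    ForAllLarge.of_le ⌈Real.exp 3⌉₊ fun D _ χ hD _ _ =>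
      adm72_conj (adm72_cSeq χ (by rw [← ell]; exact le_ell_of_ceil_exp_le hD))
  have hR := meanSq_le_of_sj_small c' h22 h23 h81 h71 (B := 2)
    (fun D χ n => conj ((if n ∈ ((Finset.Ico 1 ⌈P2pp D * etaPM D 1⌉₊).filter
          (fun n : ℕ => P1pp D * etaPM D (-1) < n ∧ (n : ℝ) < P2pp D * etaPM D 1)) then
          χ (n : ZMod D) * (((n : ℝ) / P1pp D : ℝ) : ℂ) ^ beta6 D * ((dualInt D n / 0.504 : ℝ) : ℂ)
        else 0) -
        (if n ∈ ((Finset.Ico 1 ⌈P2pp D⌉₊).filter (fun n : ℕ => P1pp D < n ∧ (n : ℝ) < P2pp D)) then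
          χ (n : ZMod D) * (((n : ℝ) / P1pp D : ℝ) : ℂ) ^ beta6 D *
            ((Real.log ((n : ℝ) / P1pp D) / Real.log (Skeleton.P1 D) : ℝ) : ℂ)
        else 0))) hadm
    (fun ε' hε' => (hS ε' hε').mono fun D _ χ _ _ h hA' j hj => by
      convert h hA' j hj using 3
      funext n
      exact Complex.conj_conj _)
    (ε / 20) (by positivity)
  -- thresholds
  set M₁ : ℝ := 20 * (C₁ ^ 2 + 1) * Km / (c₁ * ε * a₀) with hM₁
  set M₂ : ℝ := 20 * (C₂ ^ 2 + 1) * Km / (c₂ * ε * a₀) with hM₂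
  set M₃ : ℝ := 45 * π ^ 2 * (C₅ ^ 2 + 1) * Kp / (ε * a₀) with hM₃
  set M : ℝ := max (max (max M₁ M₂) M₃) 4 with hMdef
  have hM4 : 4 ≤ M := le_max_right _ _
  obtain ⟨D₀, h⟩ :=
    ((((((((h22.and h23).and hFE).and hT).and hU).and hMass).and hPoly).and hE2).and hR).and hA
  refine ⟨max D₀ ⌈Real.exp M⌉₊, fun D _ χ hD hq hp hAss => ?_⟩
  have hD₀ : D₀ ≤ D := le_trans (le_max_left _ _) hD
  obtain ⟨hMℓ, hℓ4, hlog3, hD3, hκ⟩ := sizes_of_le hM4 (le_trans (le_max_right _ _) hD)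
  have hℓ : 0 < ell D := by linarith
  have hℓ1 : 1 ≤ ell D := by linarith
  have hM₁ℓ : M₁ ≤ ell D :=
    le_trans (le_trans (le_trans (le_max_left _ _) (le_max_left _ _)) (le_max_left _ _)) hMℓ
  have hM₂ℓ : M₂ ≤ ell D :=
    le_trans (le_trans (le_trans (le_max_right _ _) (le_max_left _ _)) (le_max_left _ _)) hMℓ
  have hM₃ℓ : M₃ ≤ ell D := le_trans (le_trans (le_max_right _ _) (le_max_left _ _)) hMℓ
  obtain ⟨⟨⟨⟨⟨⟨⟨⟨⟨h22', h23'⟩, hFE'⟩, hT'⟩, hU'⟩, hMass'⟩, hPoly'⟩, hE2'⟩, hR'⟩, hA'⟩ :=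
    h D χ hD₀ hq hp
  have ha : a₀ ≤ frakA χ := hA' hAss
  have hfa : 0 ≤ frakA χ := le_trans ha₀.le ha
  have hP : 0 ≤ frakP D := frakP_nonneg D
  -- pointwise facts at the zeros
  have mem : ∀ i ∈ idx χ, i.1 ∈ PsiOne χ ∧ i.2 ∈ zeroSet D i.1 := fun i hi => mem_idx χ hi
  have hre : ∀ i ∈ idx χ, i.2.re = 1 / 2 := fun i hi =>
    h22' i.1 (mem i hi).1 i.2 (mem_prodZeroSetOmega_of_mem_zeroSet χ (mem i hi).2)
  have hwin : ∀ i ∈ idx χ, |i.2.im - 2 * π * t0 D| < ell1 D := fun i hi => (mem i hi).2.2.1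
  have him : ∀ i ∈ idx χ, 0 < i.2.im := fun i hi => im_pos_of_mem_zeroSet hD3 (mem i hi).2
  have hc0 : ∀ i ∈ idx χ, 0 ≤ (cstar c' D i.1 i.2).re := fun i hi =>
    (h23' i.1 (mem i hi).1 i.2 (mem i hi).2).2
  have hω : ∀ i ∈ idx χ, 0 < (omegaW D i.2).re := fun i hi => (omegaW_re_pos hD3 (hre i hi)).1
  have hZ1 : ∀ i ∈ idx χ, ‖Zpc χ i.1 i.2‖ = 1 := fun i hi =>
    norm_Zpc_eq_one χ (psiChiPrimitive_holds D χ i.1 hD3 hp) (hre i hi) (him i hi)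
  -- the constants of the day
  set e₁ : ℝ := Real.exp (-c₁ * ell D ^ 10) with he₁
  set τ₂ : ℝ := C₂ * Real.exp (-c₂ * ell D ^ 10) with hτ₂
  set κ : ℝ := C₅ * (3 * alpha D / 2) * (ell D ^ 68)⁻¹ with hκdef
  -- termwise bound
  have hterm : ∀ i ∈ idx χ,
      (cstar c' D i.1 i.2).re * ‖(Zpc χ i.1 i.2)⁻¹ * Htilde15 χ i.1 i.2 - Hbar16 χ i.1 (1 - i.2)‖ ^ 2 *
          (omegaW D i.2).re ≤
        5 * C₁ ^ 2 * ((cstar c' D i.1 i.2).re * E2main χ i.1 (i.2 + beta6 D) ^ 2 * (omegaW D i.2).re) +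
        5 * ((C₁ * e₁) ^ 2 + τ₂ ^ 2) * ((cstar c' D i.1 i.2).re * (omegaW D i.2).re) +
        5 * κ ^ 2 * ((cstar c' D i.1 i.2).re *
          ‖Apoly i.1 (fun n : ℕ => conj (if n ∈ ((Finset.Ico 1 ⌈P2pp D * etaPM D 1⌉₊).filter
          (fun n : ℕ => P1pp D * etaPM D (-1) < n ∧ (n : ℝ) < P2pp D * etaPM D 1)) then
          χ (n : ZMod D) * (((n : ℝ) / P1pp D : ℝ) : ℂ) ^ beta6 D * ((dualInt D n / 0.504 : ℝ) : ℂ)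
        else 0)) i.2‖ ^ 2 * (omegaW D i.2).re) +
        5 * ((cstar c' D i.1 i.2).re *
          ‖Apoly i.1 (fun n : ℕ => conj ((if n ∈ ((Finset.Ico 1 ⌈P2pp D * etaPM D 1⌉₊).filter
          (fun n : ℕ => P1pp D * etaPM D (-1) < n ∧ (n : ℝ) < P2pp D * etaPM D 1)) then
          χ (n : ZMod D) * (((n : ℝ) / P1pp D : ℝ) : ℂ) ^ beta6 D * ((dualInt D n / 0.504 : ℝ) : ℂ)
        else 0) -
        (if n ∈ ((Finset.Ico 1 ⌈P2pp D⌉₊).filter (fun n : ℕ => P1pp D < n ∧ (n : ℝ) < P2pp D)) then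
          χ (n : ZMod D) * (((n : ℝ) / P1pp D : ℝ) : ℂ) ^ beta6 D *
            ((Real.log ((n : ℝ) / P1pp D) / Real.log (Skeleton.P1 D) : ℝ) : ℂ)
        else 0))) i.2‖ ^ 2 * (omegaW D i.2).re) := by
    intro i hi
    have hb := pointwise_sq_bound χ i.1 hlog3 hκ (hre i hi) (hZ1 i hi)
      (hFE' hAss i.1 i.2 (hre i hi) (hwin i hi)) (hT' i.1 i.2 (hre i hi) (hwin i hi))
      (hU' i.1 i.2 (hre i hi) (hwin i hi))
    have h2 := mul_le_mul_of_nonneg_right (mul_le_mul_of_nonneg_left hb (hc0 i hi)) (hω i hi).le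
    refine le_trans h2 (le_of_eq ?_)
    ring
  -- the four mean squares
  have hSE : ∑ i ∈ idx χ, (cstar c' D i.1 i.2).re * E2main χ i.1 (i.2 + beta6 D) ^ 2 *
      (omegaW D i.2).re ≤ ε₁ * frakA χ * frakP D := by
    have := hE2' hAss
    rw [msE2shift] at this
    exact le_trans (le_abs_self _) this
  have hS1 : ∑ i ∈ idx χ, (cstar c' D i.1 i.2).re * (omegaW D i.2).re ≤ Km * ell D ^ 9 * frakP D :=
    hMass' hAss
  have hSA : ∑ i ∈ idx χ, (cstar c' D i.1 i.2).re *
      ‖Apoly i.1 (fun n : ℕ => conj (if n ∈ ((Finset.Ico 1 ⌈P2pp D * etaPM D 1⌉₊).filter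
          (fun n : ℕ => P1pp D * etaPM D (-1) < n ∧ (n : ℝ) < P2pp D * etaPM D 1)) then
          χ (n : ZMod D) * (((n : ℝ) / P1pp D : ℝ) : ℂ) ^ beta6 D * ((dualInt D n / 0.504 : ℝ) : ℂ)
        else 0)) i.2‖ ^ 2 * (omegaW D i.2).re ≤
        Kp * ell D ^ 81 * frakP D :=
    hPoly' hAss _ (adm72_conj (adm72_c0 χ hlog3))
  have hSR : ∑ i ∈ idx χ, (cstar c' D i.1 i.2).re *
      ‖Apoly i.1 (fun n : ℕ => conj ((if n ∈ ((Finset.Ico 1 ⌈P2pp D * etaPM D 1⌉₊).filter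
          (fun n : ℕ => P1pp D * etaPM D (-1) < n ∧ (n : ℝ) < P2pp D * etaPM D 1)) then
          χ (n : ZMod D) * (((n : ℝ) / P1pp D : ℝ) : ℂ) ^ beta6 D * ((dualInt D n / 0.504 : ℝ) : ℂ)
        else 0) -
        (if n ∈ ((Finset.Ico 1 ⌈P2pp D⌉₊).filter (fun n : ℕ => P1pp D < n ∧ (n : ℝ) < P2pp D)) then
          χ (n : ZMod D) * (((n : ℝ) / P1pp D : ℝ) : ℂ) ^ beta6 D *
            ((Real.log ((n : ℝ) / P1pp D) / Real.log (Skeleton.P1 D) : ℝ) : ℂ)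
        else 0))) i.2‖ ^ 2 * (omegaW D i.2).re ≤ ε / 20 * frakA χ * frakP D :=
    hR' hAss
  -- sizes of the constants
  have hexp1 : 5 * ((C₁ * e₁) ^ 2) * (Km * ell D ^ 9 * frakP D) ≤ ε / 8 * a₀ * frakP D := by
    have hM₁' : 20 * (C₁ ^ 2 + 1) * Km ≤ c₁ * ε * a₀ * ell D := by
      have := (div_le_iff₀ (by positivity : 0 < c₁ * ε * a₀)).mp hM₁ℓ
      linarith
    exact exp_budget hc₁ hε ha₀ hKm hℓ hP hM₁'
  have hexp2 : 5 * (τ₂ ^ 2) * (Km * ell D ^ 9 * frakP D) ≤ ε / 8 * a₀ * frakP D := by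
    have hM₂' : 20 * (C₂ ^ 2 + 1) * Km ≤ c₂ * ε * a₀ * ell D := by
      have := (div_le_iff₀ (by positivity : 0 < c₂ * ε * a₀)).mp hM₂ℓ
      linarith
    exact exp_budget hc₂ hε ha₀ hKm hℓ hP hM₂'
  have hkap : 5 * κ ^ 2 * (Kp * ell D ^ 81 * frakP D) ≤ ε / 4 * a₀ * frakP D := by
    have hα : alpha D = π / ell D ^ 9 := by rw [alpha, bigP, Real.log_exp]
    have hM₃' : 45 * π ^ 2 * (C₅ ^ 2 + 1) * Kp ≤ ε * a₀ * ell D := by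
      have := (div_le_iff₀ (by positivity : 0 < ε * a₀)).mp hM₃ℓ
      linarith
    rw [hκdef, hα]
    exact kappa_budget hε ha₀ hKp hℓ1 hP hM₃'
  have hC₁ε : 5 * C₁ ^ 2 * (ε₁ * frakA χ * frakP D) ≤ ε / 4 * frakA χ * frakP D := by
    have h1 : 5 * C₁ ^ 2 * ε₁ ≤ ε / 4 := by
      rw [hε₁def, show 5 * C₁ ^ 2 * (ε / (20 * (C₁ ^ 2 + 1))) = (ε / 4) * (C₁ ^ 2 / (C₁ ^ 2 + 1)) by
        field_simp; ring]
      have : C₁ ^ 2 / (C₁ ^ 2 + 1) ≤ 1 := by rw [div_le_one (by positivity)]; linarith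
      nlinarith
    calc 5 * C₁ ^ 2 * (ε₁ * frakA χ * frakP D) = (5 * C₁ ^ 2 * ε₁) * (frakA χ * frakP D) := by ring
      _ ≤ (ε / 4) * (frakA χ * frakP D) := mul_le_mul_of_nonneg_right h1 (mul_nonneg hfa hP)
      _ = ε / 4 * frakA χ * frakP D := by ring
  -- assemble
  have hms0 : 0 ≤ ms128 c' χ := by
    rw [ms128]
    exact Finset.sum_nonneg fun i hi => mul_nonneg (mul_nonneg (hc0 i hi) (sq_nonneg _)) (hω i hi).le
  rw [abs_of_nonneg hms0, ms128]
  calc ∑ i ∈ idx χ, (cstar c' D i.1 i.2).re *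
        ‖(Zpc χ i.1 i.2)⁻¹ * Htilde15 χ i.1 i.2 - Hbar16 χ i.1 (1 - i.2)‖ ^ 2 * (omegaW D i.2).re
      ≤ ∑ i ∈ idx χ,
        (5 * C₁ ^ 2 * ((cstar c' D i.1 i.2).re * E2main χ i.1 (i.2 + beta6 D) ^ 2 * (omegaW D i.2).re) +
        5 * ((C₁ * e₁) ^ 2 + τ₂ ^ 2) * ((cstar c' D i.1 i.2).re * (omegaW D i.2).re) +
        5 * κ ^ 2 * ((cstar c' D i.1 i.2).re *
          ‖Apoly i.1 (fun n : ℕ => conj (if n ∈ ((Finset.Ico 1 ⌈P2pp D * etaPM D 1⌉₊).filter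
          (fun n : ℕ => P1pp D * etaPM D (-1) < n ∧ (n : ℝ) < P2pp D * etaPM D 1)) then
          χ (n : ZMod D) * (((n : ℝ) / P1pp D : ℝ) : ℂ) ^ beta6 D * ((dualInt D n / 0.504 : ℝ) : ℂ)
        else 0)) i.2‖ ^ 2 * (omegaW D i.2).re) +
        5 * ((cstar c' D i.1 i.2).re *
          ‖Apoly i.1 (fun n : ℕ => conj ((if n ∈ ((Finset.Ico 1 ⌈P2pp D * etaPM D 1⌉₊).filter
          (fun n : ℕ => P1pp D * etaPM D (-1) < n ∧ (n : ℝ) < P2pp D * etaPM D 1)) then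
          χ (n : ZMod D) * (((n : ℝ) / P1pp D : ℝ) : ℂ) ^ beta6 D * ((dualInt D n / 0.504 : ℝ) : ℂ)
        else 0) -
        (if n ∈ ((Finset.Ico 1 ⌈P2pp D⌉₊).filter (fun n : ℕ => P1pp D < n ∧ (n : ℝ) < P2pp D)) then
          χ (n : ZMod D) * (((n : ℝ) / P1pp D : ℝ) : ℂ) ^ beta6 D *
            ((Real.log ((n : ℝ) / P1pp D) / Real.log (Skeleton.P1 D) : ℝ) : ℂ)
        else 0))) i.2‖ ^ 2 * (omegaW D i.2).re)) := Finset.sum_le_sum hterm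
    _ = 5 * C₁ ^ 2 * (∑ i ∈ idx χ, (cstar c' D i.1 i.2).re * E2main χ i.1 (i.2 + beta6 D) ^ 2 *
            (omegaW D i.2).re) +
        5 * ((C₁ * e₁) ^ 2 + τ₂ ^ 2) * (∑ i ∈ idx χ, (cstar c' D i.1 i.2).re * (omegaW D i.2).re) +
        5 * κ ^ 2 * (∑ i ∈ idx χ, (cstar c' D i.1 i.2).re *
          ‖Apoly i.1 (fun n : ℕ => conj (if n ∈ ((Finset.Ico 1 ⌈P2pp D * etaPM D 1⌉₊).filter
          (fun n : ℕ => P1pp D * etaPM D (-1) < n ∧ (n : ℝ) < P2pp D * etaPM D 1)) then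
          χ (n : ZMod D) * (((n : ℝ) / P1pp D : ℝ) : ℂ) ^ beta6 D * ((dualInt D n / 0.504 : ℝ) : ℂ)
        else 0)) i.2‖ ^ 2 * (omegaW D i.2).re) +
        5 * (∑ i ∈ idx χ, (cstar c' D i.1 i.2).re *
          ‖Apoly i.1 (fun n : ℕ => conj ((if n ∈ ((Finset.Ico 1 ⌈P2pp D * etaPM D 1⌉₊).filter
          (fun n : ℕ => P1pp D * etaPM D (-1) < n ∧ (n : ℝ) < P2pp D * etaPM D 1)) then
          χ (n : ZMod D) * (((n : ℝ) / P1pp D : ℝ) : ℂ) ^ beta6 D * ((dualInt D n / 0.504 : ℝ) : ℂ)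
        else 0) -
        (if n ∈ ((Finset.Ico 1 ⌈P2pp D⌉₊).filter (fun n : ℕ => P1pp D < n ∧ (n : ℝ) < P2pp D)) then
          χ (n : ZMod D) * (((n : ℝ) / P1pp D : ℝ) : ℂ) ^ beta6 D *
            ((Real.log ((n : ℝ) / P1pp D) / Real.log (Skeleton.P1 D) : ℝ) : ℂ)
        else 0))) i.2‖ ^ 2 * (omegaW D i.2).re) := by
        rw [Finset.sum_add_distrib, Finset.sum_add_distrib, Finset.sum_add_distrib,
          ← Finset.mul_sum, ← Finset.mul_sum, ← Finset.mul_sum, ← Finset.mul_sum]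
    _ ≤ 5 * C₁ ^ 2 * (ε₁ * frakA χ * frakP D) +
        5 * ((C₁ * e₁) ^ 2 + τ₂ ^ 2) * (Km * ell D ^ 9 * frakP D) +
        5 * κ ^ 2 * (Kp * ell D ^ 81 * frakP D) +
        5 * (ε / 20 * frakA χ * frakP D) := by
        gcongr
    _ = 5 * C₁ ^ 2 * (ε₁ * frakA χ * frakP D) +
        (5 * ((C₁ * e₁) ^ 2) * (Km * ell D ^ 9 * frakP D) +
          5 * (τ₂ ^ 2) * (Km * ell D ^ 9 * frakP D)) +
        5 * κ ^ 2 * (Kp * ell D ^ 81 * frakP D) + ε / 4 * frakA χ * frakP D := by ring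
    _ ≤ ε / 4 * frakA χ * frakP D + (ε / 8 * a₀ * frakP D + ε / 8 * a₀ * frakP D) +
        ε / 4 * a₀ * frakP D + ε / 4 * frakA χ * frakP D := by
        gcongr
    _ ≤ ε / 4 * frakA χ * frakP D + (ε / 8 * frakA χ * frakP D + ε / 8 * frakA χ * frakP D) +
        ε / 4 * frakA χ * frakP D + ε / 4 * frakA χ * frakP D := by
        gcongr
    _ = ε * frakA χ * frakP D := by ring

/-- **(12.8) from the PRINTED approximate functional equation node and the window estimate**: the
typed `Typed.Sec12A.Htilde15ApproxFE` (error `C·E(s+β₆,ψ)`, no `ε`-term) implies the repaired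
hypothesis of `eq128_of_sj_small` (with `|C|`, `c = 1`), so the cell's `Ded128R` holds in the form
`Htilde15ApproxFE → hS → Eq128 c′` given Lemma 2.3, Prop. 2.2 (i), Lemma 8.1, Prop. 7.1.
[cite: Zhang2022LandauSiegel, §12 (12.8) p.67] -/
theorem eq128_of_htilde15ApproxFE_of_sj_small (c' : ℝ) (h22 : Prop22i) (h23 : Lemma23 c')
    (h81 : Lemma81 c') (h71 : Prop71 c') (hFE : Htilde15ApproxFE)
    (hS : ∀ ε : ℝ, 0 < ε → ForAllLarge fun D _ χ => AssumptionA D χ →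
      ∀ j ∈ ({1, 2, 3} : Finset ℕ),
        ‖Sj c' D j
            (fun n : ℕ => conj ((if n ∈ ((Finset.Ico 1 ⌈P2pp D * etaPM D 1⌉₊).filter
          (fun n : ℕ => P1pp D * etaPM D (-1) < n ∧ (n : ℝ) < P2pp D * etaPM D 1)) then
          χ (n : ZMod D) * (((n : ℝ) / P1pp D : ℝ) : ℂ) ^ beta6 D * ((dualInt D n / 0.504 : ℝ) : ℂ)
        else 0) -
        (if n ∈ ((Finset.Ico 1 ⌈P2pp D⌉₊).filter (fun n : ℕ => P1pp D < n ∧ (n : ℝ) < P2pp D)) then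
          χ (n : ZMod D) * (((n : ℝ) / P1pp D : ℝ) : ℂ) ^ beta6 D *
            ((Real.log ((n : ℝ) / P1pp D) / Real.log (Skeleton.P1 D) : ℝ) : ℂ)
        else 0)))
            (fun n : ℕ => (if n ∈ ((Finset.Ico 1 ⌈P2pp D * etaPM D 1⌉₊).filter
          (fun n : ℕ => P1pp D * etaPM D (-1) < n ∧ (n : ℝ) < P2pp D * etaPM D 1)) then
          χ (n : ZMod D) * (((n : ℝ) / P1pp D : ℝ) : ℂ) ^ beta6 D * ((dualInt D n / 0.504 : ℝ) : ℂ)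
        else 0) -
        (if n ∈ ((Finset.Ico 1 ⌈P2pp D⌉₊).filter (fun n : ℕ => P1pp D < n ∧ (n : ℝ) < P2pp D)) then
          χ (n : ZMod D) * (((n : ℝ) / P1pp D : ℝ) : ℂ) ^ beta6 D *
            ((Real.log ((n : ℝ) / P1pp D) / Real.log (Skeleton.P1 D) : ℝ) : ℂ)
        else 0))‖ ≤
          ε * alpha D * frakA χ) :
    Eq128 c' := by
  refine eq128_of_sj_small c' h22 h23 h81 h71 ?_ hS
  obtain ⟨C, hFE⟩ := hFE
  refine ⟨1, one_pos, |C|, hFE.mono fun D _ χ _ _ h hA x s hs ht => ?_⟩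
  have h1 := h hA x s hs ht
  have hE : 0 ≤ E2main χ x (s + beta6 D) := by
    have hℓ : 0 ≤ ell D := Real.log_natCast_nonneg D
    refine mul_nonneg (inv_nonneg.mpr (pow_nonneg hℓ _)) ?_
    refine intervalIntegral.integral_nonneg (by linarith [pow_nonneg hℓ 20]) fun v _ => ?_
    exact mul_nonneg (norm_nonneg _) (Real.exp_nonneg _)
  calc ‖Htilde15 χ x s - dualPrefactor χ x s * ∑' n : ℕ, dualTerm χ x s n‖
      ≤ C * E2main χ x (s + beta6 D) := h1
    _ ≤ |C| * E2main χ x (s + beta6 D) := mul_le_mul_of_nonneg_right (le_abs_self C) hE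
    _ ≤ |C| * (E2main χ x (s + beta6 D) + Real.exp (-1 * ell D ^ 10)) := by
        refine mul_le_mul_of_nonneg_left ?_ (abs_nonneg C)
        linarith [Real.exp_nonneg (-1 * ell D ^ 10)]

/-- **The reduction, closed form**: for every sufficiently large `c′`, (12.8) (`Typed.Sec12A.Eq128 c′`)
follows from the (repaired) `H̃₁₅` approximate functional equation and the window estimate
`S_j(𝐜̄,𝐜) = o(α𝔞)` ALONE — Lemma 2.3 and Lemma 8.1 by `Skeleton.partOne_eventually`, Prop. 2.2 (i)
by `Skeleton.prop22i_holds`, Prop. 7.1 by `Section7cStatements.prop71X_holds`.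
[cite: Zhang2022LandauSiegel, §12 (12.8) p.67] -/
theorem eq128_of_sj_small_eventually :
    ∃ c₀ : ℝ, 0 ≤ c₀ ∧ ∀ c' : ℝ, c₀ ≤ c' →
      (∃ c : ℝ, 0 < c ∧ ∃ C : ℝ, ForAllLarge fun D _ χ => AssumptionA D χ → ∀ x : Chr D,
        ∀ s : ℂ, s.re = 1 / 2 → |s.im - 2 * π * t0 D| < ell1 D →
          ‖Htilde15 χ x s - dualPrefactor χ x s * ∑' n : ℕ, dualTerm χ x s n‖ ≤
            C * (E2main χ x (s + beta6 D) + Real.exp (-c * ell D ^ 10))) →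
      (∀ ε : ℝ, 0 < ε → ForAllLarge fun D _ χ => AssumptionA D χ →
        ∀ j ∈ ({1, 2, 3} : Finset ℕ),
          ‖Sj c' D j
              (fun n : ℕ => conj ((if n ∈ ((Finset.Ico 1 ⌈P2pp D * etaPM D 1⌉₊).filter
          (fun n : ℕ => P1pp D * etaPM D (-1) < n ∧ (n : ℝ) < P2pp D * etaPM D 1)) then
          χ (n : ZMod D) * (((n : ℝ) / P1pp D : ℝ) : ℂ) ^ beta6 D * ((dualInt D n / 0.504 : ℝ) : ℂ)
        else 0) -
        (if n ∈ ((Finset.Ico 1 ⌈P2pp D⌉₊).filter (fun n : ℕ => P1pp D < n ∧ (n : ℝ) < P2pp D)) then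
          χ (n : ZMod D) * (((n : ℝ) / P1pp D : ℝ) : ℂ) ^ beta6 D *
            ((Real.log ((n : ℝ) / P1pp D) / Real.log (Skeleton.P1 D) : ℝ) : ℂ)
        else 0)))
              (fun n : ℕ => (if n ∈ ((Finset.Ico 1 ⌈P2pp D * etaPM D 1⌉₊).filter
          (fun n : ℕ => P1pp D * etaPM D (-1) < n ∧ (n : ℝ) < P2pp D * etaPM D 1)) then
          χ (n : ZMod D) * (((n : ℝ) / P1pp D : ℝ) : ℂ) ^ beta6 D * ((dualInt D n / 0.504 : ℝ) : ℂ)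
        else 0) -
        (if n ∈ ((Finset.Ico 1 ⌈P2pp D⌉₊).filter (fun n : ℕ => P1pp D < n ∧ (n : ℝ) < P2pp D)) then
          χ (n : ZMod D) * (((n : ℝ) / P1pp D : ℝ) : ℂ) ^ beta6 D *
            ((Real.log ((n : ℝ) / P1pp D) / Real.log (Skeleton.P1 D) : ℝ) : ℂ)
        else 0))‖ ≤
            ε * alpha D * frakA χ) →
      Eq128 c' := by
  obtain ⟨c₀, h0, h⟩ := partOne_eventually
  exact ⟨c₀, h0, fun c' hc' hFE hS =>
    eq128_of_sj_small c' prop22i_holds (h c' hc').2.1 (h c' hc').2.2.1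
      (Section7cStatements.prop71X_holds c') hFE hS⟩

end Reduction

end Literature.NumberTheory.LFunctions.Zhang2022.Typed.Sec12A
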